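import Literature.Geometry.Riemannian.BishopVolumeComparison
import Literature.Geometry.Lorentzian.GeodesicConfinement
import Literature.Geometry.Lorentzian.VolumePositivity
import HarnessLib

/-!
# The Bishop–Gromov relative volume comparison theorem under `Ric ≥ n - 1`

Let `(M, g)` be a connected Riemannian `m`-manifold, `m ≥ 2`, modelled on
`ℝᵐ = EuclideanSpace ℝ (Fin m)`, whose closed distance balls are compact (e.g. `M` compact), with
`Ric ≥ (m - 1) g`. We PROVE Gromov's relative volume comparison theorem (Chavel 2006,
Thm. III.4.5 "(M. Gromov)": `V(x; r)/V_κ(r)` is nonincreasing in `r`, `κ = 1`; Lee 2018,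
Thm. 11.19; Cheeger–Colding 1997, (0.5)) in the division-free form: for `0 < r ≤ R ≤ π`,

  `Vol_g B̄_R(p) · V₁(r) ≤ Vol_g B̄_r(p) · V₁(R)`,   `V₁(y) = |S^{m-1}| ∫₀ʸ sin^{m-1}`,

and its consequence on a closed manifold (Myers: `M = B̄_π(p)`, `V₁(π) = |Sᵐ|`): the LOWER bound
`Vol_g B̄_r(p) · |Sᵐ| ≥ Vol_g(M) · V₁(r)` for every ball — the form in which relative volume
comparison enters Colding's proof of `Colding1996_volume_ghClose` (lower bounds for the volume of
small balls, e.g. Colding 1997 *Aspects*, proof sketches in §2; Hu–Yin 2015, Lemma 4.1 (ii),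
Lemma 5.2) and Gromov's precompactness theorem.

## The proof (Chavel 2006, Prop. III.4.1, Lemma III.4.1 and Thm. III.4.5, run through `exp_p`
without the measure of the cut locus)

Frame `T_pM` by a `g_p`-orthonormal basis (`exists_framing_of_orthonormal`), `T : ℝᵐ ≃ T_pM`,
`F = exp_p ∘ T`, and polar coordinates `v = t ξ` on `ℝᵐ` (Mathlib's
`measurePreserving_homeomorphUnitSphereProd`: Lebesgue measure on `ℝᵐ ∖ {0}` is the product of
the measure `toSphere` on the unit sphere, of total mass `|S^{m-1}|`, and `t^{m-1} dt`). For a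
direction `ξ` let `f_ξ(t) = 𝒥_F(t ξ) t^{m-1}` as long as `γ_{Tξ}|[0, t]` is minimizing and
`f_ξ(t) = 0` past the cut time. Then
* `Vol B̄_R(p) ≤ ∫_{U_R} 𝒥_F = ∫_ξ ∫₀ᴿ f_ξ` by Hopf–Rinow and the area formula, inequality half
  (`riemVolume_image_le_lintegral_jacobian`; `U_R` = minimizing directions of norm `≤ R`);
* `Vol B̄_r(p) ≥ Vol F(L_r) = ∫_{L_r} 𝒥_F = ∫_ξ ∫₀ʳ f_ξ` by the area formula, equality half, on
  the injectivity domain (`riemVolume_image_eq_lintegral_jacobian`,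
  `injOn_riemannianExpMap_injectivityDomain`; per direction the injectivity domain and the closed
  segment domain differ in at most the cut point, a Lebesgue-null set);
* per direction, Bishop's monotone comparison (§1: `f_ξ/sin^{m-1}` satisfies the cross
  inequality of Prop. III.4.1 before the cut time, trivially after it) fed into Gromov's lemma on
  ratios of integrals (`integral_mul_integral_le_of_le_right`, `VolumeSphereTheoremProofs.lean`
  §2) gives `(∫₀ᴿ f_ξ)(∫₀ʳ sin^{m-1}) ≤ (∫₀ʳ f_ξ)(∫₀ᴿ sin^{m-1})`; integrate over `ξ`.

§5 restates the lower bound in the binders of the named fact `Colding1996_volume_ghClose`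
(`Bundle.ContMDiffRiemannianMetric`, `riemannianMeasure`, `Manifold.riemannianEDist`); §6 is its
contrapositive use in Colding's Gromov–Hausdorff assembly: a set whose complement has measure
`< Vol(M) · V₁(ε)/|Sᵐ|` is `ε`-dense (in both vocabularies); §7 is the packing bound
`#F · V₁(ε/2) ≤ |Sᵐ|` for `ε`-separated sets `F` (Gromov's volume counting); §8: under the
volume hypothesis `Vol(M) ≥ (1 − δ)|Sᵐ|` of Colding's theorem every ball has
`Vol B̄_r(p) ≥ (1 − δ) V₁(r)` (in both vocabularies).

No definitions, no named facts (D-0026).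

## References

* I. Chavel, *Riemannian Geometry: A Modern Introduction*, 2nd ed., CUP 2006, §III.4:
  Thm. III.4.3, Prop. III.4.1, Lemma III.4.1 (Gromov's lemma), Thm. III.4.5 "(M. Gromov (1982,
  1986))" (read: `lit read book:chavel2006-riemannian-geometry-modern-introduction`, PDF
  pp. 105–106). [Chavel2006]
* J. M. Lee, *Introduction to Riemannian Manifolds*, 2nd ed., Springer GTM 176, 2018, Thm. 11.19
  (Bishop–Gromov). [LeeRiemannianManifolds2018]
* J. Cheeger, T. H. Colding, J. Differential Geom. 46 (1997), (0.5). [CheegerColding1997]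
* T. H. Colding, *Aspects of Ricci curvature*, MSRI Publ. 30 (1997), Thm. 2.2. [Colding1997Aspects]
-/

noncomputable section

open Bundle Set Function Filter MeasureTheory Manifold
open scoped Manifold ContDiff Topology ENNReal NNReal

namespace Literature.Geometry.Riemannian

open Lorentzian Lorentzian.PseudoRiemannianMetric

/-! ### §1. Bishop's monotone comparison along a direction, through the exponential map -/

section UnitSpeed

variable {E : Type*} [NormedAddCommGroup E] [NormedSpace ℝ E] [FiniteDimensional ℝ E]
  [CompleteSpace E] {M : Type*} [TopologicalSpace M] [ChartedSpace E M] [IsManifold 𝓘(ℝ, E) ∞ M]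
  [T2Space M]
  (g : PseudoRiemannianMetric 𝓘(ℝ, E) ∞ E (TangentSpace 𝓘(ℝ, E) : M → Type _)) [g.HasLeviCivita]
  [CovariantDerivative.ContMDiffCovariantDerivative g.leviCivita 1]
  [CovariantDerivative.ContMDiffCovariantDerivative g.leviCivita ∞]

/-- **Bishop's comparison theorem, monotone form, transferred to the exponential map** (Chavel
2006, Thm. III.4.3 ⇔ Prop. III.4.1: "(III.4.12) is equivalent to saying that
`det 𝒜(t;ξ)/S_κ^{n-1}(t)` is decreasing", `κ = 1`). For a smooth Riemannian metric with complete
Levi-Civita connection, `dim M ≥ 2`, `Ric ≥ (dim M - 1) g`, a `g`-unit vector `u ∈ T_pM` with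
`γ_u|[0, ℓ]` minimizing, any basis `b` of `T_pM = E` and `0 < s ≤ t ≤ ℓ`, the division-free
cross inequality `𝒥_b(t u) t^{dim M-1} sin^{dim M-1} s ≤ 𝒥_b(s u) s^{dim M-1} sin^{dim M-1} t`
holds for the Gram–Jacobian `𝒥_b(w) = √det (g(d(exp_p)_w bᵢ, d(exp_p)_w bⱼ))` of `exp_p`: in a
full parallel orthonormal frame `𝒥_b(y u) yᵏ = C det 𝒜(y)` (`det_gram_mfderiv_expMap_frame`,
change of Gram basis) and `det 𝒜/sinᵏ` is nonincreasing on `(0, ℓ)` by the matrix Riccati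
comparison `jacobi_det_div_sin_pow_antitoneOn` (no conjugate points before `ℓ`; `ℓ ≤ π`), the end point
`t = ℓ` by continuity.
[cite: Chavel2006, Thm. III.4.3 and Prop. III.4.1] -/
theorem sqrt_det_gram_mfderiv_expMap_cross_le_of_unit (hg : g.IsRiemannian)
    (hc : IsGeodesicallyComplete g.leviCivita) (hdim : 2 ≤ Module.finrank ℝ E)
    (hRic : ∀ (x : M) (w : TangentSpace 𝓘(ℝ, E) x),
      ((Module.finrank ℝ E : ℝ) - 1) * g.val x w w ≤ g.leviCivita.ricci x w w)
    (p : M) (u : E) (hu : g.val p u u = 1) {ℓ : ℝ} (hℓ : 0 < ℓ)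
    (hmin : IsMinimizingUpTo g hg p u ℓ) {ι : Type*} [Fintype ι] [DecidableEq ι]
    (b : Module.Basis ι ℝ E) {s t : ℝ} (hs : 0 < s) (hst : s ≤ t) (htℓ : t ≤ ℓ) :
    Real.sqrt (Matrix.of fun i j ↦
      g.val (expMap g.leviCivita p (t • u))
        (mfderiv 𝓘(ℝ, E) 𝓘(ℝ, E) (fun w : E ↦ expMap g.leviCivita p w) (t • u) (b i))
        (mfderiv 𝓘(ℝ, E) 𝓘(ℝ, E) (fun w : E ↦ expMap g.leviCivita p w) (t • u) (b j))).det *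
        t ^ (Module.finrank ℝ E - 1) * Real.sin s ^ (Module.finrank ℝ E - 1) ≤
      Real.sqrt (Matrix.of fun i j ↦
      g.val (expMap g.leviCivita p (s • u))
        (mfderiv 𝓘(ℝ, E) 𝓘(ℝ, E) (fun w : E ↦ expMap g.leviCivita p w) (s • u) (b i))
        (mfderiv 𝓘(ℝ, E) 𝓘(ℝ, E) (fun w : E ↦ expMap g.leviCivita p w) (s • u) (b j))).det *
        s ^ (Module.finrank ℝ E - 1) * Real.sin t ^ (Module.finrank ℝ E - 1) := by
  have ht : t ∈ Ioc 0 ℓ := ⟨hs.trans_le hst, htℓ⟩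
  have hs' : s ∈ Ioc 0 ℓ := ⟨hs, hst.trans ht.2⟩
  have hLC := PseudoRiemannianMetric.isLeviCivita_leviCivita_holds (g := g)
  have hreg : g.leviCivita.IsLocallyContMDiff 1 :=
    hLC.isLocallyContMDiff_one (WithTop.coe_le_coe.mpr le_top)
  have hinf : g.leviCivita.IsLocallyContMDiff (⊤ : ℕ∞) := hLC.isLocallyContMDiff ⊤ (le_of_eq rfl)
  have h2 : (2 : ℕ∞ω) ≤ (∞ : ℕ∞ω) := WithTop.coe_le_coe.2 le_top
  have h0 : (0 : ℝ) ∈ Ioo (-1) (ℓ + 1) := ⟨by norm_num, by linarith⟩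
  have h0' : (0 : ℝ) ∈ Ioo (-1) ℓ := ⟨by norm_num, hℓ⟩
  have hsub : ∀ {t : ℝ}, t ∈ Ioo (-1 : ℝ) ℓ → t ∈ Ioo (-1) (ℓ + 1) := fun ht ↦
    ⟨ht.1, ht.2.trans (lt_add_one ℓ)⟩
  have hsub0 : ∀ {t : ℝ}, t ∈ Ioo (0 : ℝ) ℓ → t ∈ Ioo (-1) (ℓ + 1) := fun ht ↦
    ⟨by linarith [ht.1], ht.2.trans (lt_add_one ℓ)⟩
  have hIoc : ∀ {t : ℝ}, t ∈ Ioc (0 : ℝ) ℓ → t ∈ Ioo (-1) (ℓ + 1) := fun ht ↦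
    ⟨by linarith [ht.1], by linarith [ht.2]⟩
  -- a full parallel orthonormal frame along `γ_u` headed by `γ̇_u`, and the matrix Jacobi data
  obtain ⟨k, f, hfnone, hfpar, hon, hcard⟩ :=
    exists_fullFrame_along_maximalGeodesic g hg hc p u hu h0
  obtain ⟨-, hgeo, hγ0, -⟩ := maximalGeodesic_of_isGeodesicallyComplete hc p u
  obtain ⟨hA, hA', hR, htr, hA0, hA'0, hdet, hnormal⟩ :=
    normalJacobiTensor_frame_explicit g hreg h2 hc p u h0 f hfnone hfpar hon hcard
  have hRc := continuousAt_frameMatrix_curvature g g.leviCivita hreg hinf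
    (hgeo.mono (subset_univ _)) hfpar h0
  -- `card (Fin k) = dim M - 1 ≥ 1`
  have hk : Fintype.card (Fin k) = Module.finrank ℝ E - 1 := by
    rw [Fintype.card_option] at hcard
    omega
  have hk1 : 1 ≤ k := by
    have := Fintype.card_fin k
    omega
  haveI : Nonempty (Fin k) := ⟨⟨0, hk1⟩⟩
  have hkR : ((Fintype.card (Fin k) : ℕ) : ℝ) = (Module.finrank ℝ E : ℝ) - 1 := by
    rw [hk, Nat.cast_sub (by omega)]
    simp
  -- no conjugate points on `(0, ℓ)`: `t u ∈ ID(p)`, as `γ_{tu}` minimises up to `ℓ / t > 1`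
  have hinj : ∀ t ∈ Ioo (0 : ℝ) ℓ, Injective (mfderiv 𝓘(ℝ, E) 𝓘(ℝ, E)
      (fun w : E ↦ expMap g.leviCivita p (show TangentSpace 𝓘(ℝ, E) p from w))
      (t • (show E from u))) := by
    intro t ht
    have ht0 : t ≠ 0 := ht.1.ne'
    have hID : t • u ∈ injectivityDomain g hg p := by
      refine ⟨ℓ / t, (one_lt_div ht.1).2 ht.2, ?_⟩
      refine (isMinimizingUpTo_smul_iff hg hc p u ht.1 (ℓ / t)).2 ?_
      rw [show t * (ℓ / t) = ℓ by field_simp]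
      exact hmin
    exact mfderiv_riemannianExpMap_injective_of_mem_injectivityDomain g le_rfl hg hc p hID
  have hdet' : ∀ t ∈ Ioo (0 : ℝ) ℓ, (Matrix.of fun i k' ↦ g.val (maximalGeodesic g.leviCivita p u t)
      (velocity 𝓘(ℝ, E) (fun s' : ℝ ↦ maximalGeodesic g.leviCivita p
        (u + s' • (show E from f 0 (some k'))) t) 0) (f t (some i))).det ≠ 0 :=
    fun t ht ↦ hdet t (hsub0 ht) ht.1.ne' (hinj t ht)
  -- the Ricci hypothesis along the unit-speed geodesic: `tr ℛ(t) ≥ dim M - 1 = card (Fin k)`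
  have hRic' : ∀ t ∈ Ioo (0 : ℝ) ℓ, ((Fintype.card (Fin k) : ℕ) : ℝ) ≤
      (Matrix.of fun i j ↦ g.val (maximalGeodesic g.leviCivita p u t) (g.leviCivita.curvature
        (maximalGeodesic g.leviCivita p u t) (f t (some j))
        (velocity 𝓘(ℝ, E) (maximalGeodesic g.leviCivita p u) t)
        (velocity 𝓘(ℝ, E) (maximalGeodesic g.leviCivita p u) t)) (f t (some i))).trace := by
    intro t ht
    have hunit : g.val (maximalGeodesic g.leviCivita p u t)
        (velocity 𝓘(ℝ, E) (maximalGeodesic g.leviCivita p u) t)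
        (velocity 𝓘(ℝ, E) (maximalGeodesic g.leviCivita p u) t) = 1 := by
      have h := hon t (hsub0 ht) none none
      rw [hfnone t] at h
      simpa using h
    have h := hRic _ (velocity 𝓘(ℝ, E) (maximalGeodesic g.leviCivita p u) t)
    rw [hunit, mul_one] at h
    rw [hkR, htr t (hsub0 ht)]
    exact h
  -- Bishop: `det A ≤ sin^k` on `(0, min ℓ π)`, `ℓ ≤ π`, and `det A > 0` on `(0, ℓ)`
  have hle := jacobi_det_le_sin_pow h0' (fun t ht ↦ hA t (hsub ht))
    (fun t ht ↦ hA' t (hsub ht)) (fun t ht ↦ hR t (hsub ht)) hRc hA0 hA'0 hdet' hRic'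
  have hℓπ : ℓ ≤ Real.pi := jacobi_noConjugate_length_le_pi h0' (fun t ht ↦ hA t (hsub ht))
    (fun t ht ↦ hA' t (hsub ht)) (fun t ht ↦ hR t (hsub ht)) hRc hA0 hA'0 hdet' hRic'
  have hpos := jacobi_det_pos h0' (fun t ht ↦ hA t (hsub ht)) hA0 hA'0 hdet'
  have hanti := jacobi_det_div_sin_pow_antitoneOn h0' (fun t ht ↦ hA t (hsub ht))
    (fun t ht ↦ hA' t (hsub ht)) (fun t ht ↦ hR t (hsub ht)) hRc hA0 hA'0 hdet' hRic'
  rw [min_eq_left hℓπ] at hle hanti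
  -- abbreviations
  set A : ℝ → Matrix (Fin k) (Fin k) ℝ := fun t ↦ Matrix.of fun i k' ↦
    g.val (maximalGeodesic g.leviCivita p u t)
      (velocity 𝓘(ℝ, E) (fun s' : ℝ ↦ maximalGeodesic g.leviCivita p
        (u + s' • (show E from f 0 (some k'))) t) 0) (f t (some i)) with hA_def
  -- `0 ≤ det A ≤ sin^k` on `(0, ℓ]`, the endpoint by continuity
  have hAc : ContinuousAt A ℓ :=
    (hasDerivAt_iff_hasFDerivAt.1 (hA ℓ ⟨by linarith, lt_add_one ℓ⟩)).continuousAt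
  have hdetc : ContinuousAt (fun s ↦ (A s).det) ℓ :=
    (continuous_id.matrix_det.continuousAt).comp hAc
  have hbound : ∀ t ∈ Ioc (0 : ℝ) ℓ, 0 ≤ (A t).det ∧ (A t).det ≤ Real.sin t ^ Fintype.card (Fin k) := by
    intro t ht
    rcases ht.2.lt_or_eq with htl | htl
    · exact ⟨(hpos t ⟨ht.1, htl⟩).le, hle t ⟨ht.1, htl⟩⟩
    · subst htl
      have hev : ∀ᶠ s in 𝓝[<] t, 0 ≤ (A s).det ∧ (A s).det ≤ Real.sin s ^ Fintype.card (Fin k) :=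
        eventually_of_mem (Ioo_mem_nhdsLT ht.1) fun s hs ↦ ⟨(hpos s hs).le, hle s hs⟩
      have hT : Tendsto (fun s ↦ (A s).det) (𝓝[<] t) (𝓝 (A t).det) :=
        hdetc.tendsto.mono_left nhdsWithin_le_nhds
      have hS : Tendsto (fun s ↦ Real.sin s ^ Fintype.card (Fin k)) (𝓝[<] t)
          (𝓝 (Real.sin t ^ Fintype.card (Fin k))) :=
        ((Real.continuous_sin.pow _).tendsto t).mono_left nhdsWithin_le_nhds
      exact ⟨ge_of_tendsto hT (hev.mono fun s hs ↦ hs.1),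
        le_of_tendsto_of_tendsto hT hS (hev.mono fun s hs ↦ hs.2)⟩
  -- the differential `L t = d(exp_p)_{tu}` and the pulled-back metric `g_{γ(t)}(L t ·, L t ·)`
  set L : ℝ → (E →L[ℝ] E) := fun t ↦
    mfderiv 𝓘(ℝ, E) 𝓘(ℝ, E) (fun w : E ↦ expMap g.leviCivita p w) (t • u)
  set B : ℝ → LinearMap.BilinForm ℝ E := fun t ↦
    LinearMap.BilinForm.comp
      (g.val (maximalGeodesic g.leviCivita p u t) : E →L[ℝ] E →L[ℝ] ℝ).toLinearMap₁₂
      (L t : E →ₗ[ℝ] E) (L t : E →ₗ[ℝ] E)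
  have hB_apply : ∀ t y z, B t y z = g.val (maximalGeodesic g.leviCivita p u t) (L t y) (L t z) :=
    fun t y z ↦ rfl
  -- the frame at `p` is a basis of `T_pM = E`: change of Gram basis, with constant `√det g_p(b,b)`
  set x : Option (Fin k) → E := fun o ↦ f 0 o
  have hx : LinearIndependent ℝ x :=
    linearIndependent_of_bilin_orthonormal (V := E) (g.val (maximalGeodesic g.leviCivita p u 0))
      (hon 0 h0)
  obtain ⟨C, hC, hCgram⟩ := exists_sqrt_det_gram_eq_mul_sqrt_det_gram b hx hcard
  have hJac : ∀ t, Real.sqrt (Matrix.of fun i j ↦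
      g.val (maximalGeodesic g.leviCivita p u t) (L t (b i)) (L t (b j))).det =
      C * Real.sqrt (Matrix.of fun o o' ↦
        g.val (maximalGeodesic g.leviCivita p u t) (L t (x o)) (L t (x o'))).det := by
    intro t
    have h := hCgram (B t)
    simp only [hB_apply] at h
    exact h
  -- the Gram determinant on the frame is `det A(x)² / x^{2k}`, `x ∈ (0, ℓ]`
  have hsqrt : ∀ y ∈ Ioc (0 : ℝ) ℓ, Real.sqrt (Matrix.of fun o o' ↦
      g.val (maximalGeodesic g.leviCivita p u y) (L y (x o)) (L y (x o'))).det *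
        y ^ Fintype.card (Fin k) = (A y).det := by
    intro y hy
    have hgram : (Matrix.of fun o o' ↦
        g.val (maximalGeodesic g.leviCivita p u y) (L y (x o)) (L y (x o'))).det *
          y ^ (2 * Fintype.card (Fin k)) = (A y).det ^ 2 :=
      det_gram_mfderiv_expMap_frame g hc p u f hfnone hon hcard hnormal (hIoc hy) hy.1.ne'
    have hyk : 0 < y ^ Fintype.card (Fin k) := pow_pos hy.1 _
    have hG : (Matrix.of fun o o' ↦
        g.val (maximalGeodesic g.leviCivita p u y) (L y (x o)) (L y (x o'))).det =
        ((A y).det / y ^ Fintype.card (Fin k)) ^ 2 := by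
      rw [div_pow, ← pow_mul, eq_div_iff (pow_ne_zero _ hy.1.ne'), mul_comm (Fintype.card (Fin k)) 2]
      exact hgram
    rw [hG, Real.sqrt_sq_eq_abs, abs_of_nonneg (div_nonneg (hbound y hy).1 hyk.le),
      div_mul_cancel₀ _ hyk.ne']
  -- the per-direction cross inequality `det A(t) sinᵏ s ≤ det A(s) sinᵏ t`
  have hsin : ∀ y ∈ Ioo (0 : ℝ) ℓ, 0 < Real.sin y := fun y hy ↦
    Real.sin_pos_of_pos_of_lt_pi hy.1 (hy.2.trans_le hℓπ)
  have hcross' : ∀ y, s ≤ y → y < ℓ → (A y).det * Real.sin s ^ Fintype.card (Fin k) ≤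
      (A s).det * Real.sin y ^ Fintype.card (Fin k) := by
    intro y hsy hyℓ
    have h := hanti ⟨hs, hsy.trans_lt hyℓ⟩ ⟨hs.trans_le hsy, hyℓ⟩ hsy
    simp only at h
    rw [div_le_div_iff₀ (pow_pos (hsin y ⟨hs.trans_le hsy, hyℓ⟩) _)
      (pow_pos (hsin s ⟨hs, hsy.trans_lt hyℓ⟩) _)] at h
    exact h
  have hcross : (A t).det * Real.sin s ^ Fintype.card (Fin k) ≤
      (A s).det * Real.sin t ^ Fintype.card (Fin k) := by
    rcases htℓ.lt_or_eq with hlt | heq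
    · exact hcross' t hst hlt
    · rcases hst.lt_or_eq with hslt | hseq
      · -- `t = ℓ`: pass to the limit `y ↑ ℓ` in the cross inequality
        have hev : ∀ᶠ y in 𝓝[<] t, (A y).det * Real.sin s ^ Fintype.card (Fin k) ≤
            (A s).det * Real.sin y ^ Fintype.card (Fin k) :=
          eventually_of_mem (Ioo_mem_nhdsLT hslt) fun y hy ↦ hcross' y hy.1.le (heq ▸ hy.2)
        have hT1 : Tendsto (fun y ↦ (A y).det * Real.sin s ^ Fintype.card (Fin k)) (𝓝[<] t)
            (𝓝 ((A t).det * Real.sin s ^ Fintype.card (Fin k))) :=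
          ((heq ▸ hdetc).tendsto.mul_const _).mono_left nhdsWithin_le_nhds
        have hT2 : Tendsto (fun y ↦ (A s).det * Real.sin y ^ Fintype.card (Fin k)) (𝓝[<] t)
            (𝓝 ((A s).det * Real.sin t ^ Fintype.card (Fin k))) :=
          ((((Real.continuous_sin.pow _).tendsto t).const_mul _)).mono_left nhdsWithin_le_nhds
        exact le_of_tendsto_of_tendsto hT1 hT2 hev
      · subst hseq
        exact le_rfl
  -- `exp_p (y u) = γ_u y`
  have hpt : ∀ y : ℝ, expMap g.leviCivita p (y • u) = maximalGeodesic g.leviCivita p u y :=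
    fun y ↦ expMap_smul hc p u y
  have heqt : Real.sqrt (Matrix.of fun i j ↦ g.val (maximalGeodesic g.leviCivita p u t)
      (L t (b i)) (L t (b j))).det * t ^ Fintype.card (Fin k) = C * (A t).det := by
    rw [hJac t, mul_assoc, hsqrt t ht]
  have heqs : Real.sqrt (Matrix.of fun i j ↦ g.val (maximalGeodesic g.leviCivita p u s)
      (L s (b i)) (L s (b j))).det * s ^ Fintype.card (Fin k) = C * (A s).det := by
    rw [hJac s, mul_assoc, hsqrt s hs']
  have key : Real.sqrt (Matrix.of fun i j ↦ g.val (maximalGeodesic g.leviCivita p u t)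
      (L t (b i)) (L t (b j))).det * t ^ Fintype.card (Fin k) * Real.sin s ^ Fintype.card (Fin k) ≤
      Real.sqrt (Matrix.of fun i j ↦ g.val (maximalGeodesic g.leviCivita p u s)
      (L s (b i)) (L s (b j))).det * s ^ Fintype.card (Fin k) * Real.sin t ^ Fintype.card (Fin k) := by
    rw [heqt, heqs, mul_assoc, mul_assoc]
    exact mul_le_mul_of_nonneg_left hcross hC.le
  rw [hk] at key
  show Real.sqrt (Matrix.of fun i j ↦ g.val (expMap g.leviCivita p (t • u))
      (L t (b i)) (L t (b j))).det * t ^ (Module.finrank ℝ E - 1) *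
      Real.sin s ^ (Module.finrank ℝ E - 1) ≤
    Real.sqrt (Matrix.of fun i j ↦ g.val (expMap g.leviCivita p (s • u))
      (L s (b i)) (L s (b j))).det * s ^ (Module.finrank ℝ E - 1) *
      Real.sin t ^ (Module.finrank ℝ E - 1)
  rw [hpt t, hpt s]
  exact key


end UnitSpeed

/-! ### §2. Continuity of the Gram–Jacobian of a `C¹` map `ℝᵐ → M` -/

section Jacobian

variable {m : ℕ} {M : Type*} [TopologicalSpace M] [ChartedSpace (EuclideanSpace ℝ (Fin m)) M]
  [IsManifold (𝓡 m) ∞ M]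
  (g : PseudoRiemannianMetric (𝓡 m) ∞ (EuclideanSpace ℝ (Fin m)) (TangentSpace (𝓡 m) : M → Type _))

/-- **The pulled-back quadratic form of a `C¹` map is continuous**: for `F : ℝᵐ → M` of class
`C¹` and a fixed `w ∈ ℝᵐ`, `v ↦ g_{F v}(dF_v w, dF_v w)` is continuous — the length function
`g(ζ, ζ)` is continuous on `TM` (`PseudoRiemannianMetric.continuous_val_tangentBundle`) and
`v ↦ (F v, dF_v w) = TF(v, w)` is continuous (`ContMDiff.continuous_tangentMap`, the tangent
bundle of `ℝᵐ` being the product `tangentBundleModelSpaceHomeomorph`). [folklore] -/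
theorem continuous_val_mfderiv_apply_self {F : EuclideanSpace ℝ (Fin m) → M}
    (hF : ContMDiff 𝓘(ℝ, EuclideanSpace ℝ (Fin m)) (𝓡 m) 1 F) (w : EuclideanSpace ℝ (Fin m)) :
    Continuous fun v : EuclideanSpace ℝ (Fin m) ↦ g.val (F v)
      (mfderiv 𝓘(ℝ, EuclideanSpace ℝ (Fin m)) (𝓡 m) F v w)
      (mfderiv 𝓘(ℝ, EuclideanSpace ℝ (Fin m)) (𝓡 m) F v w) := by
  have h1 : Continuous (tangentMap 𝓘(ℝ, EuclideanSpace ℝ (Fin m)) (𝓡 m) F) :=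
    hF.continuous_tangentMap le_rfl
  have h2 : Continuous fun v : EuclideanSpace ℝ (Fin m) ↦
      ((tangentBundleModelSpaceHomeomorph 𝓘(ℝ, EuclideanSpace ℝ (Fin m))).symm
        ((v, w) : ModelProd (EuclideanSpace ℝ (Fin m)) (EuclideanSpace ℝ (Fin m))) :
          TangentBundle 𝓘(ℝ, EuclideanSpace ℝ (Fin m)) (EuclideanSpace ℝ (Fin m))) :=
    (Homeomorph.continuous _).comp (continuous_id.prodMk continuous_const)
  exact (g.continuous_val_tangentBundle.comp (h1.comp h2)).congr fun v ↦ rfl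

/-- **Polarization** for a symmetric continuous bilinear form:
`B(x, y) = (B(x+y, x+y) - B(x, x) - B(y, y))/2`. [folklore] -/
theorem bilin_apply_eq_polarization {V : Type*} [AddCommGroup V] [Module ℝ V]
    [TopologicalSpace V] (B : V →L[ℝ] V →L[ℝ] ℝ) (hB : ∀ x y, B x y = B y x) (x y : V) :
    B x y = (B (x + y) (x + y) - B x x - B y y) / 2 := by
  simp only [map_add, _root_.add_apply]
  rw [hB y x]
  ring

/-- **The Gram–Jacobian of a `C¹` map `F : ℝᵐ → M` is continuous**:
`v ↦ √det (g_{F v}(dF_v eᵢ, dF_v eⱼ))ᵢⱼ` (entries continuous by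
`continuous_val_mfderiv_apply_self` and polarization `bilin_apply_eq_polarization`). [folklore] -/
theorem continuous_sqrt_det_gram_mfderiv {F : EuclideanSpace ℝ (Fin m) → M}
    (hF : ContMDiff 𝓘(ℝ, EuclideanSpace ℝ (Fin m)) (𝓡 m) 1 F) :
    Continuous fun v : EuclideanSpace ℝ (Fin m) ↦ Real.sqrt (Matrix.det (Matrix.of
      fun i j : Fin m ↦ g.val (F v)
        (mfderiv 𝓘(ℝ, EuclideanSpace ℝ (Fin m)) (𝓡 m) F v (EuclideanSpace.single i (1 : ℝ)))
        (mfderiv 𝓘(ℝ, EuclideanSpace ℝ (Fin m)) (𝓡 m) F v (EuclideanSpace.single j (1 : ℝ))))) := by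
  have hq := fun w ↦ continuous_val_mfderiv_apply_self g hF w
  have hentry : ∀ i j : Fin m, Continuous fun v : EuclideanSpace ℝ (Fin m) ↦ g.val (F v)
      (mfderiv 𝓘(ℝ, EuclideanSpace ℝ (Fin m)) (𝓡 m) F v (EuclideanSpace.single i (1 : ℝ)))
      (mfderiv 𝓘(ℝ, EuclideanSpace ℝ (Fin m)) (𝓡 m) F v (EuclideanSpace.single j (1 : ℝ))) := by
    intro i j
    refine ((((hq (EuclideanSpace.single i (1 : ℝ) + EuclideanSpace.single j (1 : ℝ))).sub
      (hq (EuclideanSpace.single i (1 : ℝ)))).sub (hq (EuclideanSpace.single j (1 : ℝ)))).div_const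
        2).congr fun v ↦ ?_
    have hadd : mfderiv 𝓘(ℝ, EuclideanSpace ℝ (Fin m)) (𝓡 m) F v
        (EuclideanSpace.single i (1 : ℝ) + EuclideanSpace.single j (1 : ℝ)) =
        mfderiv 𝓘(ℝ, EuclideanSpace ℝ (Fin m)) (𝓡 m) F v (EuclideanSpace.single i (1 : ℝ)) +
          mfderiv 𝓘(ℝ, EuclideanSpace ℝ (Fin m)) (𝓡 m) F v (EuclideanSpace.single j (1 : ℝ)) :=
      map_add _ _ _
    have hpol := bilin_apply_eq_polarization (g.val (F v)) (fun x y ↦ g.symm (F v) x y)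
      (mfderiv 𝓘(ℝ, EuclideanSpace ℝ (Fin m)) (𝓡 m) F v (EuclideanSpace.single i (1 : ℝ)))
      (mfderiv 𝓘(ℝ, EuclideanSpace ℝ (Fin m)) (𝓡 m) F v (EuclideanSpace.single j (1 : ℝ)))
    rw [← hadd] at hpol
    exact hpol.symm
  have hM : Continuous fun v : EuclideanSpace ℝ (Fin m) ↦ (Matrix.of fun i j : Fin m ↦ g.val (F v)
      (mfderiv 𝓘(ℝ, EuclideanSpace ℝ (Fin m)) (𝓡 m) F v (EuclideanSpace.single i (1 : ℝ)))
      (mfderiv 𝓘(ℝ, EuclideanSpace ℝ (Fin m)) (𝓡 m) F v (EuclideanSpace.single j (1 : ℝ)))) :=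
    continuous_pi fun i ↦ continuous_pi fun j ↦ hentry i j
  exact (hM.matrix_det).sqrt

end Jacobian

/-! ### §3. Polar coordinates for Lebesgue integrals on `ℝᵐ` -/

section Polar

/-- **Integration in polar coordinates on `ℝᵐ`, `m = k + 1`** (Chavel 2006, §III.3, (III.3.5)
in the model space; Mathlib's `measurePreserving_homeomorphUnitSphereProd`): for a measurable
`G : ℝᵐ → [0, ∞]`,
`∫ G dv = ∫_{ξ ∈ S^{m-1}} ∫_{t > 0} t^{m-1} G(t ξ) dt dσ(ξ)`, `σ = volume.toSphere` the measure
induced by Lebesgue measure on the unit sphere (total mass `|S^{m-1}|`, `toSphere_volume_univ`).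
[cite: Chavel2006, (III.3.5)] -/
theorem lintegral_eq_lintegral_sphere_radial (k : ℕ)
    (G : EuclideanSpace ℝ (Fin (k + 1)) → ℝ≥0∞) (hG : Measurable G) :
    ∫⁻ v, G v = ∫⁻ ξ : Metric.sphere (0 : EuclideanSpace ℝ (Fin (k + 1))) 1,
      (∫⁻ t in Ioi (0 : ℝ), ENNReal.ofReal (t ^ k) * G (t • (ξ : EuclideanSpace ℝ (Fin (k + 1)))))
        ∂(volume : Measure (EuclideanSpace ℝ (Fin (k + 1)))).toSphere := by
  set f : ↥(Metric.sphere (0 : EuclideanSpace ℝ (Fin (k + 1))) 1) × ↥(Ioi (0 : ℝ)) → ℝ≥0∞ :=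
    fun q ↦ G ((q.2 : ℝ) • (q.1 : EuclideanSpace ℝ (Fin (k + 1)))) with hf_def
  have hmeas : Measurable f :=
    hG.comp ((measurable_subtype_coe.comp measurable_snd).smul
      (measurable_subtype_coe.comp measurable_fst))
  have hfin : Module.finrank ℝ (EuclideanSpace ℝ (Fin (k + 1))) - 1 = k := by
    rw [finrank_euclideanSpace_fin, Nat.add_sub_cancel]
  calc ∫⁻ v, G v
      = ∫⁻ x : ({(0 : EuclideanSpace ℝ (Fin (k + 1)))}ᶜ : Set (EuclideanSpace ℝ (Fin (k + 1)))),
          G (x : EuclideanSpace ℝ (Fin (k + 1))) ∂((volume : Measure (EuclideanSpace ℝ (Fin (k + 1)))).comap Subtype.val) := by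
        rw [lintegral_subtype_comap (measurableSet_singleton _).compl, restrict_compl_singleton]
    _ = ∫⁻ x : ({(0 : EuclideanSpace ℝ (Fin (k + 1)))}ᶜ : Set (EuclideanSpace ℝ (Fin (k + 1)))),
          f (homeomorphUnitSphereProd (EuclideanSpace ℝ (Fin (k + 1))) x) ∂((volume : Measure (EuclideanSpace ℝ (Fin (k + 1)))).comap Subtype.val) := by
        refine lintegral_congr fun x ↦ ?_
        have hx : (x : EuclideanSpace ℝ (Fin (k + 1))) ≠ 0 := x.2
        simp only [hf_def, homeomorphUnitSphereProd_apply_snd_coe,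
          homeomorphUnitSphereProd_apply_fst_coe, smul_inv_smul₀ (norm_ne_zero_iff.2 hx)]
    _ = ∫⁻ q, f q ∂((volume : Measure (EuclideanSpace ℝ (Fin (k + 1)))).toSphere.prod
          (Measure.volumeIoiPow (Module.finrank ℝ (EuclideanSpace ℝ (Fin (k + 1))) - 1))) :=
        ((volume : Measure (EuclideanSpace ℝ (Fin (k + 1)))).measurePreserving_homeomorphUnitSphereProd).lintegral_comp_emb
          (Homeomorph.measurableEmbedding _) f
    _ = ∫⁻ ξ, ∫⁻ t, f (ξ, t) ∂(Measure.volumeIoiPow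
          (Module.finrank ℝ (EuclideanSpace ℝ (Fin (k + 1))) - 1))
          ∂(volume : Measure (EuclideanSpace ℝ (Fin (k + 1)))).toSphere :=
        lintegral_prod _ hmeas.aemeasurable
    _ = _ := by
        rw [hfin]
        refine lintegral_congr fun ξ ↦ ?_
        have hm1 : Measurable fun r : ↥(Ioi (0 : ℝ)) ↦ ENNReal.ofReal ((r : ℝ) ^ k) :=
          ENNReal.measurable_ofReal.comp (measurable_subtype_coe.pow_const _)
        have hm2 : Measurable fun r : ↥(Ioi (0 : ℝ)) ↦ f (ξ, r) :=
          hmeas.comp (measurable_const.prodMk measurable_id)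
        rw [Measure.volumeIoiPow, lintegral_withDensity_eq_lintegral_mul _ hm1 hm2,
          ← lintegral_subtype_comap measurableSet_Ioi
            (fun t ↦ ENNReal.ofReal (t ^ k) * G (t • (ξ : EuclideanSpace ℝ (Fin (k + 1)))))]
        rfl

/-- **Polar coordinates for the integral over a measurable set** `S ⊆ ℝᵐ`:
`∫_S Φ = ∫_{ξ} ∫_{t > 0} t^{m-1} 𝟙_S(t ξ) Φ(t ξ) dt dσ(ξ)`. [cite: Chavel2006, (III.3.5)] -/
theorem setLIntegral_eq_lintegral_sphere_radial (k : ℕ)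
    {Φ : EuclideanSpace ℝ (Fin (k + 1)) → ℝ≥0∞} (hΦ : Measurable Φ)
    {S : Set (EuclideanSpace ℝ (Fin (k + 1)))} (hS : MeasurableSet S) :
    ∫⁻ v in S, Φ v = ∫⁻ ξ : Metric.sphere (0 : EuclideanSpace ℝ (Fin (k + 1))) 1,
      (∫⁻ t in Ioi (0 : ℝ), ENNReal.ofReal (t ^ k) *
        S.indicator Φ (t • (ξ : EuclideanSpace ℝ (Fin (k + 1)))))
        ∂(volume : Measure (EuclideanSpace ℝ (Fin (k + 1)))).toSphere := by
  rw [← lintegral_indicator hS]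
  exact lintegral_eq_lintegral_sphere_radial k (S.indicator Φ) (hΦ.indicator hS)

end Polar

/-! ### §4. The relative volume comparison theorem on the manifold -/

section Main

variable {m : ℕ} {M : Type*} [TopologicalSpace M] [T2Space M] [SecondCountableTopology M]
  [ChartedSpace (EuclideanSpace ℝ (Fin m)) M] [IsManifold (𝓡 m) ∞ M] [T3Space M]
  [MeasurableSpace M] [BorelSpace M]
  (g : PseudoRiemannianMetric (𝓡 m) ∞ (EuclideanSpace ℝ (Fin m)) (TangentSpace (𝓡 m) : M → Type _))
  [ConnectedSpace M] [g.HasLeviCivita]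

set_option maxHeartbeats 800000 in
-- the assembled proof (framing, area formula twice, polar coordinates, Gromov's lemma) is long
/-- **The Bishop–Gromov relative volume comparison theorem** (Chavel 2006, Thm. III.4.5
"(M. Gromov (1982, 1986))": under `Ric ≥ (n-1)κ`, `V(x; r)/V_κ(r)` is nonincreasing in `r`;
Lee 2018, Thm. 11.19; Cheeger–Colding 1997, (0.5)), `κ = 1`, in division-free form. Let `(M, g)`
be a connected Riemannian `m`-manifold, `m ≥ 2`, modelled on `ℝᵐ`, whose closed distance balls
are compact, with `Ric ≥ (m - 1) g`. Then for `p ∈ M` and `0 < r ≤ R ≤ π`,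
`Vol B̄_R(p) · ∫₀ʳ sin^{m-1} ≤ Vol B̄_r(p) · ∫₀ᴿ sin^{m-1}` (closed metric balls; multiply by
`|S^{m-1}|` for `V₁`). Proof: polar coordinates `v = t ξ` in `T_pM ≅ ℝᵐ` framed orthonormally
(`exists_framing_of_orthonormal`, `lintegral_eq_lintegral_sphere_radial`), the area formula for
`F = exp_p ∘ T` — inequality half on the minimizing directions of norm `≤ R` for the numerator
(`riemVolume_image_le_lintegral_jacobian`), equality half on the injectivity domain for the
denominator (`riemVolume_image_eq_lintegral_jacobian`), the two differing by at most the cut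
point in each direction — and, direction by direction, Bishop's monotone comparison
(`sqrt_det_gram_mfderiv_expMap_cross_le_of_unit`) fed into Gromov's lemma on ratios of integrals
(`integral_mul_integral_le_of_le_right`). [cite: Chavel2006, Thm. III.4.5]
[cite: CheegerColding1997, (0.5)] -/
theorem riemVolume_closedBall_mul_le_of_ricci_ge (hg : g.IsRiemannian) (hm : 2 ≤ m)
    (hcpl : ∀ (x : M) (r : ℝ≥0), IsCompact {y : M | g.edist hg x y ≤ r})
    (hRic : ∀ (x : M) (w : TangentSpace (𝓡 m) x), ((m : ℝ) - 1) * g.val x w w ≤ g.ricci x w w)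
    (p : M) {r R : ℝ} (hr0 : 0 < r) (hrR : r ≤ R) (hRπ : R ≤ Real.pi) :
    g.riemVolume {y : M | g.edist hg p y ≤ ENNReal.ofReal R} *
        ENNReal.ofReal (∫ t in (0:ℝ)..r, Real.sin t ^ (m - 1)) ≤
      g.riemVolume {y : M | g.edist hg p y ≤ ENNReal.ofReal r} *
        ENNReal.ofReal (∫ t in (0:ℝ)..R, Real.sin t ^ (m - 1)) := by
  obtain ⟨k, rfl⟩ : ∃ k, m = k + 1 := ⟨m - 1, by omega⟩
  rw [Nat.add_sub_cancel]
  have hR0 : 0 < R := hr0.trans_le hrR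
  have hrπ : r ≤ Real.pi := hrR.trans hRπ
  have hk1 : 1 ≤ k := by omega
  -- §4.0 the Levi-Civita connection of the smooth metric is `C¹` and `C^∞`, and complete
  have hk1' : ((1 : ℕ∞) : ℕ∞ω) + 1 ≤ (∞ : ℕ∞ω) := by
    rw [show ((1 : ℕ∞) : ℕ∞ω) + 1 = 2 by norm_num]
    exact WithTop.coe_le_coe.2 le_top
  haveI : CovariantDerivative.ContMDiffCovariantDerivative g.leviCivita 1 :=
    ⟨g.isLocallyContMDiff_leviCivita_holds 1 hk1' univ isOpen_univ⟩
  haveI : CovariantDerivative.ContMDiffCovariantDerivative g.leviCivita (∞ : ℕ∞ω) :=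
    ⟨g.isLocallyContMDiff_leviCivita_holds ⊤ (le_of_eq rfl) univ isOpen_univ⟩
  haveI : Fact (1 ≤ (∞ : ℕ∞ω)) := ⟨by exact_mod_cast le_top⟩
  have hc : IsGeodesicallyComplete g.leviCivita :=
    isGeodesicallyComplete_of_isCompact_closedBall hg hcpl
  have hfinE : Module.finrank ℝ (EuclideanSpace ℝ (Fin (k + 1))) = k + 1 :=
    finrank_euclideanSpace_fin
  have hRic' : ∀ (x : M) (w : TangentSpace (𝓡 (k + 1)) x),
      ((Module.finrank ℝ (EuclideanSpace ℝ (Fin (k + 1))) : ℝ) - 1) * g.val x w w ≤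
        g.leviCivita.ricci x w w := by
    intro x w
    rw [hfinE]
    exact hRic x w
  -- §4.1 a `g_p`-orthonormal basis `bx` of `T_pM = ℝᵐ` and the framing `T`, `|T v|_g = ‖v‖`
  obtain ⟨e₀, he₀⟩ := g.exists_orthonormal_basis p hg
  have hfin : Module.finrank ℝ (TangentSpace (𝓡 (k + 1)) p) = k + 1 := by
    show Module.finrank ℝ (EuclideanSpace ℝ (Fin (k + 1))) = k + 1
    exact hfinE
  set bx : Module.Basis (Fin (k + 1)) ℝ (EuclideanSpace ℝ (Fin (k + 1))) :=
    (e₀.reindex (finCongr hfin) : Module.Basis (Fin (k + 1)) ℝ (TangentSpace (𝓡 (k + 1)) p))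
    with hbx_def
  have hbxi : ∀ i, bx i = e₀ ((finCongr hfin).symm i) := fun i ↦
    e₀.reindex_apply (finCongr hfin) i
  have honx : ∀ i j, g.val p (bx i) (bx j) = if i = j then (1 : ℝ) else 0 := by
    intro i j
    rw [hbxi, hbxi, he₀]
    simp only [EmbeddingLike.apply_eq_iff_eq]
  have hgram1 : Real.sqrt (Matrix.of fun i j ↦ g.val p (bx i) (bx j)).det = 1 := by
    have h1 : (Matrix.of fun i j ↦ g.val p (bx i) (bx j)) = 1 := by
      ext i j
      rw [Matrix.of_apply, honx, Matrix.one_apply]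
    rw [h1, Matrix.det_one, Real.sqrt_one]
  obtain ⟨TE, hTE_single, hTE_sq⟩ :=
    exists_framing_of_orthonormal (k + 1) (g.val p) bx honx
  set T : EuclideanSpace ℝ (Fin (k + 1)) →L[ℝ] EuclideanSpace ℝ (Fin (k + 1)) :=
    (TE : EuclideanSpace ℝ (Fin (k + 1)) →L[ℝ] EuclideanSpace ℝ (Fin (k + 1))) with hT_def
  have hT_TE : ∀ v, T v = TE v := fun v ↦ rfl
  have hT_single : ∀ i, T (EuclideanSpace.single i (1 : ℝ)) = bx i := fun i ↦ by
    rw [hT_TE, hTE_single]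
  have hT_sq : ∀ v, g.val p (T v) (T v) = ‖v‖ ^ 2 := fun v ↦ hTE_sq v
  have hT_norm : ∀ v, Real.sqrt (g.val p (T v) (T v)) = ‖v‖ := fun v ↦ by
    rw [hT_sq v, Real.sqrt_sq (norm_nonneg _)]
  have hT_surj : ∀ w : TangentSpace (𝓡 (k + 1)) p, ∃ v, T v = w := fun w ↦ TE.surjective w
  have hT_inj : Injective T := fun v w h ↦ TE.injective h
  -- minimality along `T (c • v)` versus along `T v`
  have hmin_congr : ∀ (w w' : EuclideanSpace ℝ (Fin (k + 1))) (b : ℝ), w = w' →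
      (IsMinimizingUpTo g hg p w b ↔ IsMinimizingUpTo g hg p w' b) := by
    intro w w' b h
    subst h
    exact Iff.rfl
  have hTsmul : ∀ (c : ℝ), 0 < c → ∀ (v : EuclideanSpace ℝ (Fin (k + 1))) (b : ℝ),
      (IsMinimizingUpTo g hg p (T (c • v)) b ↔ IsMinimizingUpTo g hg p (T v) (c * b)) := by
    intro c hc0 v b
    exact (hmin_congr _ _ b (map_smul T c v)).trans
      (isMinimizingUpTo_smul_iff hg hc p (T v) hc0 b)
  -- §4.2 the map `F = exp_p ∘ T`, its Gram–Jacobian `J`, continuity, and the chain rule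
  set F : EuclideanSpace ℝ (Fin (k + 1)) → M := fun v ↦ riemannianExpMap g p (T v) with hF_def
  have hexp : ContMDiff 𝓘(ℝ, EuclideanSpace ℝ (Fin (k + 1))) (𝓡 (k + 1)) 1
      (fun u : EuclideanSpace ℝ (Fin (k + 1)) ↦ riemannianExpMap g p u) :=
    (contMDiff_riemannianExpMap g le_rfl hc p).of_le (WithTop.coe_le_coe.mpr le_top)
  have hF1 : ContMDiff 𝓘(ℝ, EuclideanSpace ℝ (Fin (k + 1))) (𝓡 (k + 1)) 1 F :=
    hexp.comp T.contMDiff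
  set J : EuclideanSpace ℝ (Fin (k + 1)) → ℝ := fun v ↦ Real.sqrt (Matrix.det (Matrix.of
    fun i j : Fin (k + 1) ↦ g.val (F v)
      (mfderiv 𝓘(ℝ, EuclideanSpace ℝ (Fin (k + 1))) (𝓡 (k + 1)) F v (EuclideanSpace.single i (1 : ℝ)))
      (mfderiv 𝓘(ℝ, EuclideanSpace ℝ (Fin (k + 1))) (𝓡 (k + 1)) F v (EuclideanSpace.single j (1 : ℝ)))))
    with hJ_def
  have hJcont : Continuous J := continuous_sqrt_det_gram_mfderiv g hF1
  have hJ0 : ∀ v, 0 ≤ J v := fun v ↦ Real.sqrt_nonneg _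
  have hchain : ∀ v i, mfderiv 𝓘(ℝ, EuclideanSpace ℝ (Fin (k + 1))) (𝓡 (k + 1)) F v
      (EuclideanSpace.single i (1 : ℝ)) =
      mfderiv 𝓘(ℝ, EuclideanSpace ℝ (Fin (k + 1))) (𝓡 (k + 1))
        (fun u : EuclideanSpace ℝ (Fin (k + 1)) ↦ riemannianExpMap g p u) (T v) (bx i) := by
    intro v i
    have h1 : HasMFDerivAt 𝓘(ℝ, EuclideanSpace ℝ (Fin (k + 1))) (𝓡 (k + 1))
        (fun u : EuclideanSpace ℝ (Fin (k + 1)) ↦ riemannianExpMap g p u) (T v)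
        (mfderiv 𝓘(ℝ, EuclideanSpace ℝ (Fin (k + 1))) (𝓡 (k + 1))
          (fun u : EuclideanSpace ℝ (Fin (k + 1)) ↦ riemannianExpMap g p u) (T v)) :=
      ((hexp (T v)).mdifferentiableAt one_ne_zero).hasMFDerivAt
    have h2 : HasMFDerivAt 𝓘(ℝ, EuclideanSpace ℝ (Fin (k + 1))) (𝓡 (k + 1)) F v
        ((mfderiv 𝓘(ℝ, EuclideanSpace ℝ (Fin (k + 1))) (𝓡 (k + 1))
          (fun u : EuclideanSpace ℝ (Fin (k + 1)) ↦ riemannianExpMap g p u) (T v)).comp T) :=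
      h1.comp v (ContinuousLinearMap.hasMFDerivAt (f := T) (x := v))
    rw [h2.mfderiv, ContinuousLinearMap.comp_apply]
    exact congrArg _ (hT_single i)
  -- the Gram–Jacobian of `F` at `v` is that of `exp_p` at `T v` on the basis `bx`
  have hJexp : ∀ v, J v = Real.sqrt (Matrix.of fun i j ↦ g.val (expMap g.leviCivita p (T v))
      (mfderiv 𝓘(ℝ, EuclideanSpace ℝ (Fin (k + 1))) 𝓘(ℝ, EuclideanSpace ℝ (Fin (k + 1)))
        (fun w : EuclideanSpace ℝ (Fin (k + 1)) ↦ expMap g.leviCivita p w) (T v) (bx i))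
      (mfderiv 𝓘(ℝ, EuclideanSpace ℝ (Fin (k + 1))) 𝓘(ℝ, EuclideanSpace ℝ (Fin (k + 1)))
        (fun w : EuclideanSpace ℝ (Fin (k + 1)) ↦ expMap g.leviCivita p w) (T v) (bx j))).det := by
    intro v
    rw [hJ_def]
    simp only [hchain]
    rfl
  -- §4.3 Bishop's monotone comparison per direction: for `‖ξ‖ = 1`, `0 < u ≤ t`,
  -- `γ_{Tξ}|[0,t]` minimizing: `J(tξ) tᵏ sinᵏ u ≤ J(uξ) uᵏ sinᵏ t`
  have hcrossJ : ∀ ξ : EuclideanSpace ℝ (Fin (k + 1)), ‖ξ‖ = 1 → ∀ u t : ℝ, 0 < u → u ≤ t →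
      IsMinimizingUpTo g hg p (T ξ) t →
      J (t • ξ) * t ^ k * Real.sin u ^ k ≤ J (u • ξ) * u ^ k * Real.sin t ^ k := by
    intro ξ hξ u t hu hut hmin
    have hunit : g.val p (T ξ) (T ξ) = 1 := by rw [hT_sq, hξ, one_pow]
    have key := sqrt_det_gram_mfderiv_expMap_cross_le_of_unit g hg hc (by rw [hfinE]; omega)
      hRic' p (T ξ) hunit (hu.trans_le hut) hmin bx hu hut le_rfl
    rw [hfinE, Nat.add_sub_cancel] at key
    have ht' : T (t • ξ) = t • T ξ := map_smul T t ξ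
    have hu' : T (u • ξ) = u • T ξ := map_smul T u ξ
    rw [hJexp (t • ξ), hJexp (u • ξ)]
    rw [ht', hu']
    exact key
  -- §4.4 the radial density `φ ξ t = J(tξ) tᵏ` before the cut time of `Tξ`, `0` after it
  set φ : EuclideanSpace ℝ (Fin (k + 1)) → ℝ → ℝ := fun ξ t ↦
    {t : ℝ | IsMinimizingUpTo g hg p (T ξ) t}.indicator (fun t ↦ J (t • ξ) * t ^ k) t with hφ_def
  have hφ_nonneg : ∀ ξ t, 0 ≤ t → 0 ≤ φ ξ t := by
    intro ξ t ht
    simp only [hφ_def]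
    by_cases hmem : t ∈ {t : ℝ | IsMinimizingUpTo g hg p (T ξ) t}
    · rw [Set.indicator_of_mem hmem]
      exact mul_nonneg (hJ0 _) (pow_nonneg ht _)
    · rw [Set.indicator_of_notMem hmem]
  have hclosed : ∀ ξ : EuclideanSpace ℝ (Fin (k + 1)),
      IsClosed {t : ℝ | IsMinimizingUpTo g hg p (T ξ) t} := fun ξ ↦
    (isClosed_setOf_isMinimizingUpTo g le_rfl hg hc p).preimage
      (continuous_const.prodMk continuous_id :
        Continuous fun t : ℝ ↦ ((T ξ : EuclideanSpace ℝ (Fin (k + 1))), t))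
  have hφ_meas : ∀ ξ, Measurable (φ ξ) := by
    intro ξ
    rw [hφ_def]
    exact ((hJcont.comp (continuous_id.smul continuous_const)).mul
      (continuous_id.pow k)).measurable.indicator (hclosed ξ).measurableSet
  -- a uniform bound for `J` on the closed ball of radius `π`
  obtain ⟨B, hB⟩ := (isCompact_closedBall (0 : EuclideanSpace ℝ (Fin (k + 1))) Real.pi).exists_bound_of_continuousOn
    hJcont.continuousOn
  have hB0 : 0 ≤ B := (norm_nonneg _).trans (hB 0 (Metric.mem_closedBall_self Real.pi_pos.le))
  have hφ_bdd : ∀ ξ : EuclideanSpace ℝ (Fin (k + 1)), ‖ξ‖ = 1 → ∀ t ∈ Icc (0 : ℝ) Real.pi,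
      ‖φ ξ t‖ ≤ B * Real.pi ^ k := by
    intro ξ hξ t ht
    have hmem : t • ξ ∈ Metric.closedBall (0 : EuclideanSpace ℝ (Fin (k + 1))) Real.pi := by
      rw [mem_closedBall_zero_iff, norm_smul, hξ, mul_one, Real.norm_eq_abs, abs_of_nonneg ht.1]
      exact ht.2
    have hJB : J (t • ξ) ≤ B := (Real.le_norm_self _).trans (hB _ hmem)
    rw [Real.norm_eq_abs, abs_of_nonneg (hφ_nonneg ξ t ht.1)]
    simp only [hφ_def]
    by_cases hm : t ∈ {t : ℝ | IsMinimizingUpTo g hg p (T ξ) t}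
    · rw [Set.indicator_of_mem hm]
      exact mul_le_mul hJB (pow_le_pow_left₀ ht.1 ht.2 k) (pow_nonneg ht.1 k) hB0
    · rw [Set.indicator_of_notMem hm]
      positivity
  have hφ_int : ∀ ξ : EuclideanSpace ℝ (Fin (k + 1)), ‖ξ‖ = 1 → ∀ y, 0 ≤ y → y ≤ Real.pi →
      IntervalIntegrable (φ ξ) volume 0 y := by
    intro ξ hξ y hy0 hyπ
    rw [intervalIntegrable_iff_integrableOn_Ioc_of_le hy0]
    refine Measure.integrableOn_of_bounded (M := B * Real.pi ^ k) measure_Ioc_lt_top.ne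
      (hφ_meas ξ).aestronglyMeasurable ?_
    exact ae_restrict_of_forall_mem measurableSet_Ioc fun t ht ↦
      hφ_bdd ξ hξ t ⟨ht.1.le, ht.2.trans hyπ⟩
  -- the cross inequality for `φ ξ` against `sinᵏ` on `[0, π]`
  have hφ_cross : ∀ ξ : EuclideanSpace ℝ (Fin (k + 1)), ‖ξ‖ = 1 → ∀ u t : ℝ, 0 ≤ u → u ≤ t →
      t ≤ Real.pi → φ ξ t * Real.sin u ^ k ≤ φ ξ u * Real.sin t ^ k := by
    intro ξ hξ u t hu hut htπ
    have hsu : 0 ≤ Real.sin u := Real.sin_nonneg_of_nonneg_of_le_pi hu (hut.trans htπ)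
    have hst : 0 ≤ Real.sin t := Real.sin_nonneg_of_nonneg_of_le_pi (hu.trans hut) htπ
    by_cases hmt : t ∈ {t : ℝ | IsMinimizingUpTo g hg p (T ξ) t}
    · have hmu : u ∈ {t : ℝ | IsMinimizingUpTo g hg p (T ξ) t} :=
        IsMinimizingUpTo.mono hc hmt hu hut
      simp only [hφ_def, Set.indicator_of_mem hmt, Set.indicator_of_mem hmu]
      rcases hu.eq_or_lt with rfl | hu0
      · rw [zero_pow (by omega), mul_zero, Real.sin_zero, zero_pow (by omega), mul_zero, zero_mul]
      · exact hcrossJ ξ hξ u t hu0 hut hmt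
    · simp only [hφ_def, Set.indicator_of_notMem hmt, zero_mul]
      exact mul_nonneg (hφ_nonneg ξ u hu) (pow_nonneg hst k)
  -- Gromov's lemma per direction
  have hGromov : ∀ ξ : EuclideanSpace ℝ (Fin (k + 1)), ‖ξ‖ = 1 →
      (∫ t in (0:ℝ)..R, φ ξ t) * (∫ t in (0:ℝ)..r, Real.sin t ^ k) ≤
        (∫ t in (0:ℝ)..r, φ ξ t) * (∫ t in (0:ℝ)..R, Real.sin t ^ k) := fun ξ hξ ↦
    integral_mul_integral_le_of_le_right hr0.le hrR (hφ_int ξ hξ R hR0.le hRπ)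
      ((Real.continuous_sin.pow k).intervalIntegrable 0 R)
      (fun u t hu hut htR ↦ hφ_cross ξ hξ u t hu hut (htR.trans hRπ))
  -- §4.5 the radial integral of `φ ξ` as a Lebesgue integral over `(0, ∞)`
  set σ : Measure (Metric.sphere (0 : EuclideanSpace ℝ (Fin (k + 1))) 1) :=
    (volume : Measure (EuclideanSpace ℝ (Fin (k + 1)))).toSphere with hσ_def
  have hJm : Measurable fun v ↦ ENNReal.ofReal (J v) :=
    ENNReal.measurable_ofReal.comp hJcont.measurable
  have hinner : ∀ ξ : EuclideanSpace ℝ (Fin (k + 1)), ‖ξ‖ = 1 → ∀ ρ : ℝ, 0 < ρ → ρ ≤ Real.pi →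
      ∫⁻ t in Ioi (0:ℝ), (Ioc 0 ρ).indicator (fun t ↦ ENNReal.ofReal (φ ξ t)) t =
        ENNReal.ofReal (∫ t in (0:ℝ)..ρ, φ ξ t) := by
    intro ξ hξ ρ hρ hρπ
    rw [setLIntegral_indicator measurableSet_Ioc, inter_eq_left.2 Ioc_subset_Ioi_self,
      intervalIntegral.integral_of_le hρ.le,
      ofReal_integral_eq_lintegral_ofReal (hφ_int ξ hξ ρ hρ.le hρπ).1
        (ae_restrict_of_forall_mem measurableSet_Ioc fun t ht ↦ hφ_nonneg ξ t ht.1.le)]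
  -- §4.6 numerator: `Vol B̄_R(p) ≤ ∫_ξ ∫₀ᴿ φ ξ` (Hopf–Rinow: the minimizing directions of norm
  -- `≤ R` cover the ball; area formula, inequality half; polar coordinates)
  set U : Set (EuclideanSpace ℝ (Fin (k + 1))) :=
    {v | IsMinimizingUpTo g hg p (T v) 1 ∧ ‖v‖ ≤ R} with hU_def
  have hUm : MeasurableSet U := by
    have h1 : IsClosed {v : EuclideanSpace ℝ (Fin (k + 1)) | IsMinimizingUpTo g hg p (T v) 1} :=
      (isClosed_setOf_isMinimizingUpTo g le_rfl hg hc p).preimage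
        (T.continuous.prodMk continuous_const :
          Continuous fun v : EuclideanSpace ℝ (Fin (k + 1)) ↦ (T v, (1 : ℝ)))
    have h2 : IsClosed {v : EuclideanSpace ℝ (Fin (k + 1)) | ‖v‖ ≤ R} :=
      isClosed_le continuous_norm continuous_const
    rw [hU_def, setOf_and]
    exact (h1.inter h2).measurableSet
  have hcoverU : {y : M | g.edist hg p y ≤ ENNReal.ofReal R} ⊆ F '' U := by
    intro y hy
    obtain ⟨w, hw, hwy⟩ := exists_isMinimizingUpTo_of_isGeodesicallyComplete g le_rfl hg hc p y
    obtain ⟨v, hv⟩ := hT_surj w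
    have hd : g.edist hg p y = ENNReal.ofReal ‖v‖ := by
      rw [← hwy, edist_eq_of_isMinimizingUpTo hg hc hw, ← hv]
      exact congrArg ENNReal.ofReal (hT_norm v)
    have hy' : g.edist hg p y ≤ ENNReal.ofReal R := hy
    refine ⟨v, ⟨by rw [hv]; exact hw, ?_⟩, by rw [hF_def]; simp only; rw [hv]; exact hwy⟩
    rw [hd] at hy'
    exact (ENNReal.ofReal_le_ofReal_iff hR0.le).1 hy'
  have hU_inner : ∀ ξ : EuclideanSpace ℝ (Fin (k + 1)), ‖ξ‖ = 1 →
      ∫⁻ t in Ioi (0:ℝ), ENNReal.ofReal (t ^ k) *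
          U.indicator (fun v ↦ ENNReal.ofReal (J v)) (t • ξ) =
        ENNReal.ofReal (∫ t in (0:ℝ)..R, φ ξ t) := by
    intro ξ hξ
    rw [← hinner ξ hξ R hR0 hRπ]
    refine setLIntegral_congr_fun measurableSet_Ioi (fun t ht ↦ ?_)
    have ht0 : 0 < t := ht
    have hnorm : ‖t • ξ‖ = t := by
      rw [norm_smul, hξ, mul_one, Real.norm_eq_abs, abs_of_pos ht0]
    have hmem : t • ξ ∈ U ↔ IsMinimizingUpTo g hg p (T ξ) t ∧ t ≤ R := by
      simp only [hU_def, mem_setOf_eq, hTsmul t ht0, mul_one, hnorm]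
    by_cases htR : t ≤ R
    · rw [Set.indicator_of_mem (show t ∈ Ioc 0 R from ⟨ht0, htR⟩)]
      simp only [hφ_def]
      by_cases hmin : t ∈ {t : ℝ | IsMinimizingUpTo g hg p (T ξ) t}
      · rw [Set.indicator_of_mem (hmem.2 ⟨hmin, htR⟩), Set.indicator_of_mem hmin]
        show ENNReal.ofReal (t ^ k) * ENNReal.ofReal (J (t • ξ)) =
          ENNReal.ofReal (J (t • ξ) * t ^ k)
        rw [ENNReal.ofReal_mul (hJ0 _), mul_comm]
      · rw [Set.indicator_of_notMem (fun h ↦ hmin (hmem.1 h).1), Set.indicator_of_notMem hmin,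
          mul_zero, ENNReal.ofReal_zero]
    · rw [Set.indicator_of_notMem (fun h : t ∈ Ioc 0 R ↦ htR h.2),
        Set.indicator_of_notMem (fun h ↦ htR (hmem.1 h).2), mul_zero]
  have hupper : g.riemVolume {y : M | g.edist hg p y ≤ ENNReal.ofReal R} ≤
      ∫⁻ ξ, ENNReal.ofReal (∫ t in (0:ℝ)..R, φ ξ t) ∂σ :=
    calc g.riemVolume {y : M | g.edist hg p y ≤ ENNReal.ofReal R}
        ≤ g.riemVolume (F '' U) := measure_mono hcoverU
      _ ≤ ∫⁻ v in U, ENNReal.ofReal (J v) :=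
          riemVolume_image_le_lintegral_jacobian g hg hF1
            (fun u q hq ↦ sqrt_det_gram_mfderiv_eq_chart g hg hF1.contMDiffAt q hq) hUm
      _ = ∫⁻ ξ : Metric.sphere (0 : EuclideanSpace ℝ (Fin (k + 1))) 1, (∫⁻ t in Ioi (0 : ℝ),
            ENNReal.ofReal (t ^ k) * U.indicator (fun v ↦ ENNReal.ofReal (J v))
              (t • (ξ : EuclideanSpace ℝ (Fin (k + 1))))) ∂σ :=
          setLIntegral_eq_lintegral_sphere_radial k hJm hUm
      _ = ∫⁻ ξ, ENNReal.ofReal (∫ t in (0:ℝ)..R, φ ξ t) ∂σ :=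
          lintegral_congr fun ξ ↦ hU_inner ξ (norm_eq_of_mem_sphere ξ)
  -- §4.7 denominator: `∫_ξ ∫₀ʳ φ ξ ≤ Vol B̄_r(p)` (area formula, equality half, on the part of
  -- the injectivity domain of norm `≤ r`, which misses at most the cut time in each direction)
  set L : Set (EuclideanSpace ℝ (Fin (k + 1))) :=
    {v | (∃ q : ℚ, (1 : ℝ) < q ∧ IsMinimizingUpTo g hg p (T v) q) ∧ ‖v‖ ≤ r} with hL_def
  have hLm : MeasurableSet L := by
    have hq_closed : ∀ q : ℚ, IsClosed {v : EuclideanSpace ℝ (Fin (k + 1)) |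
        IsMinimizingUpTo g hg p (T v) q} := fun q ↦
      (isClosed_setOf_isMinimizingUpTo g le_rfl hg hc p).preimage
        (T.continuous.prodMk continuous_const :
          Continuous fun v : EuclideanSpace ℝ (Fin (k + 1)) ↦ (T v, ((q : ℚ) : ℝ)))
    have h1 : MeasurableSet {v : EuclideanSpace ℝ (Fin (k + 1)) |
        ∃ q : ℚ, (1 : ℝ) < q ∧ IsMinimizingUpTo g hg p (T v) q} := by
      have heq : {v : EuclideanSpace ℝ (Fin (k + 1)) |
          ∃ q : ℚ, (1 : ℝ) < q ∧ IsMinimizingUpTo g hg p (T v) q} =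
          ⋃ q : ℚ, ({v : EuclideanSpace ℝ (Fin (k + 1)) | (1 : ℝ) < q} ∩
            {v : EuclideanSpace ℝ (Fin (k + 1)) | IsMinimizingUpTo g hg p (T v) q}) := by
        ext v
        simp only [mem_setOf_eq, mem_iUnion, mem_inter_iff]
      rw [heq]
      exact MeasurableSet.iUnion fun q ↦
        (MeasurableSet.const _).inter (hq_closed q).measurableSet
    rw [hL_def, setOf_and]
    exact h1.inter (isClosed_le continuous_norm continuous_const).measurableSet
  have hLinj : InjOn F L := by
    intro v hv w hw hvw
    obtain ⟨⟨q, hq1, hq⟩, -⟩ := hv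
    obtain ⟨⟨q', hq1', hq'⟩, -⟩ := hw
    have hvID : (T v : TangentSpace (𝓡 (k + 1)) p) ∈ injectivityDomain g hg p := ⟨q, hq1, hq⟩
    have hwID : (T w : TangentSpace (𝓡 (k + 1)) p) ∈ injectivityDomain g hg p := ⟨q', hq1', hq'⟩
    exact hT_inj (injOn_riemannianExpMap_injectivityDomain g le_rfl hg hc p hvID hwID hvw)
  have hLsub : F '' L ⊆ {y : M | g.edist hg p y ≤ ENNReal.ofReal r} := by
    rintro _ ⟨v, ⟨⟨q, hq1, hq⟩, hvr⟩, rfl⟩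
    have hmin1 : IsMinimizingUpTo g hg p (T v) 1 := hq.mono hc zero_le_one hq1.le
    have hd : g.edist hg p (riemannianExpMap g p (T v)) = ENNReal.ofReal ‖v‖ := by
      rw [edist_eq_of_isMinimizingUpTo hg hc hmin1]
      exact congrArg ENNReal.ofReal (hT_norm v)
    show g.edist hg p (riemannianExpMap g p (T v)) ≤ ENNReal.ofReal r
    rw [hd]
    exact ENNReal.ofReal_le_ofReal hvr
  have hareaL : g.riemVolume (F '' L) = ∫⁻ v in L, ENNReal.ofReal (J v) :=
    riemVolume_image_eq_lintegral_jacobian g hg hF1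
      (fun u q hq ↦ sqrt_det_gram_mfderiv_eq_chart g hg hF1.contMDiffAt q hq) hLm hLinj
  have hL_inner : ∀ ξ : EuclideanSpace ℝ (Fin (k + 1)), ‖ξ‖ = 1 →
      ∫⁻ t in Ioi (0:ℝ), ENNReal.ofReal (t ^ k) *
          L.indicator (fun v ↦ ENNReal.ofReal (J v)) (t • ξ) =
        ENNReal.ofReal (∫ t in (0:ℝ)..r, φ ξ t) := by
    intro ξ hξ
    rw [← hinner ξ hξ r hr0 hrπ]
    -- the cut times of `T ξ` form a subsingleton, a Lebesgue-null set
    set D : Set ℝ := {t | 0 < t ∧ IsMinimizingUpTo g hg p (T ξ) t ∧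
      ∀ s : ℝ, t < s → ¬ IsMinimizingUpTo g hg p (T ξ) s} with hD_def
    have hDsub : D.Subsingleton := by
      intro t₁ ht₁ t₂ ht₂
      by_contra hne
      rcases lt_or_gt_of_ne hne with h | h
      · exact ht₁.2.2 t₂ h ht₂.2.1
      · exact ht₂.2.2 t₁ h ht₁.2.1
    have hD0 : ∀ᵐ t ∂((volume : Measure ℝ).restrict (Ioi 0)), t ∉ D :=
      ae_restrict_of_ae (measure_eq_zero_iff_ae_notMem.1 (hDsub.measure_zero volume))
    refine lintegral_congr_ae ?_
    filter_upwards [ae_restrict_mem measurableSet_Ioi, hD0] with t ht htD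
    have ht0 : 0 < t := ht
    have hnorm : ‖t • ξ‖ = t := by
      rw [norm_smul, hξ, mul_one, Real.norm_eq_abs, abs_of_pos ht0]
    have hmem : t • ξ ∈ L ↔
        (∃ q : ℚ, (1 : ℝ) < q ∧ IsMinimizingUpTo g hg p (T ξ) (t * q)) ∧ t ≤ r := by
      simp only [hL_def, mem_setOf_eq, hTsmul t ht0, hnorm]
    by_cases htr : t ≤ r
    · rw [Set.indicator_of_mem (show t ∈ Ioc 0 r from ⟨ht0, htr⟩)]
      simp only [hφ_def]
      by_cases hmin : t ∈ {t : ℝ | IsMinimizingUpTo g hg p (T ξ) t}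
      · -- `t` is not the cut time: `γ_{Tξ}` minimizes a little further, so `t • ξ ∈ L`
        have hfar : ∃ s : ℝ, t < s ∧ IsMinimizingUpTo g hg p (T ξ) s := by
          by_contra hno
          push Not at hno
          exact htD ⟨ht0, hmin, hno⟩
        obtain ⟨s, hts, hs⟩ := hfar
        obtain ⟨q, hq1, hqs⟩ := exists_rat_btwn ((one_lt_div ht0).2 hts)
        have hq : IsMinimizingUpTo g hg p (T ξ) (t * q) :=
          hs.mono hc (mul_nonneg ht0.le (zero_le_one.trans hq1.le)) ((lt_div_iff₀' ht0).1 hqs).le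
        rw [Set.indicator_of_mem (hmem.2 ⟨⟨q, hq1, hq⟩, htr⟩), Set.indicator_of_mem hmin]
        show ENNReal.ofReal (t ^ k) * ENNReal.ofReal (J (t • ξ)) =
          ENNReal.ofReal (J (t • ξ) * t ^ k)
        rw [ENNReal.ofReal_mul (hJ0 _), mul_comm]
      · have hnot : t • ξ ∉ L := fun h ↦ by
          obtain ⟨⟨q, hq1, hq⟩, -⟩ := hmem.1 h
          exact hmin (hq.mono hc ht0.le (le_mul_of_one_le_right ht0.le hq1.le))
        rw [Set.indicator_of_notMem hnot, Set.indicator_of_notMem hmin, mul_zero,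
          ENNReal.ofReal_zero]
    · rw [Set.indicator_of_notMem (fun h : t ∈ Ioc 0 r ↦ htr h.2),
        Set.indicator_of_notMem (fun h ↦ htr (hmem.1 h).2), mul_zero]
  have hlower : ∫⁻ ξ, ENNReal.ofReal (∫ t in (0:ℝ)..r, φ ξ t) ∂σ ≤
      g.riemVolume {y : M | g.edist hg p y ≤ ENNReal.ofReal r} :=
    calc ∫⁻ ξ, ENNReal.ofReal (∫ t in (0:ℝ)..r, φ ξ t) ∂σ
        = ∫⁻ ξ : Metric.sphere (0 : EuclideanSpace ℝ (Fin (k + 1))) 1, (∫⁻ t in Ioi (0 : ℝ),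
            ENNReal.ofReal (t ^ k) * L.indicator (fun v ↦ ENNReal.ofReal (J v))
              (t • (ξ : EuclideanSpace ℝ (Fin (k + 1))))) ∂σ :=
          lintegral_congr fun ξ ↦ (hL_inner ξ (norm_eq_of_mem_sphere ξ)).symm
      _ = ∫⁻ v in L, ENNReal.ofReal (J v) :=
          (setLIntegral_eq_lintegral_sphere_radial k hJm hLm).symm
      _ = g.riemVolume (F '' L) := hareaL.symm
      _ ≤ g.riemVolume {y : M | g.edist hg p y ≤ ENNReal.ofReal r} := measure_mono hLsub
  -- §4.8 assembly: Gromov's lemma direction by direction, integrated over the sphere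
  have hφi0 : ∀ (ξ : EuclideanSpace ℝ (Fin (k + 1))) (y : ℝ), 0 ≤ y →
      0 ≤ ∫ t in (0:ℝ)..y, φ ξ t := fun ξ y hy ↦
    intervalIntegral.integral_nonneg hy fun t ht ↦ hφ_nonneg ξ t ht.1
  calc g.riemVolume {y : M | g.edist hg p y ≤ ENNReal.ofReal R} *
        ENNReal.ofReal (∫ t in (0:ℝ)..r, Real.sin t ^ k)
      ≤ (∫⁻ ξ, ENNReal.ofReal (∫ t in (0:ℝ)..R, φ ξ t) ∂σ) *
          ENNReal.ofReal (∫ t in (0:ℝ)..r, Real.sin t ^ k) := mul_le_mul_left hupper _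
    _ = ∫⁻ ξ, ENNReal.ofReal ((∫ t in (0:ℝ)..R, φ ξ t) * ∫ t in (0:ℝ)..r, Real.sin t ^ k) ∂σ := by
        rw [← lintegral_mul_const' _ _ ENNReal.ofReal_ne_top]
        refine lintegral_congr fun ξ ↦ ?_
        rw [ENNReal.ofReal_mul (hφi0 ξ R hR0.le)]
    _ ≤ ∫⁻ ξ, ENNReal.ofReal ((∫ t in (0:ℝ)..r, φ ξ t) * ∫ t in (0:ℝ)..R, Real.sin t ^ k) ∂σ :=
        lintegral_mono fun ξ ↦ ENNReal.ofReal_le_ofReal (hGromov ξ (norm_eq_of_mem_sphere ξ))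
    _ = (∫⁻ ξ, ENNReal.ofReal (∫ t in (0:ℝ)..r, φ ξ t) ∂σ) *
          ENNReal.ofReal (∫ t in (0:ℝ)..R, Real.sin t ^ k) := by
        rw [← lintegral_mul_const' _ _ ENNReal.ofReal_ne_top]
        refine lintegral_congr fun ξ ↦ ?_
        rw [ENNReal.ofReal_mul (hφi0 ξ r hr0.le)]
    _ ≤ g.riemVolume {y : M | g.edist hg p y ≤ ENNReal.ofReal r} *
          ENNReal.ofReal (∫ t in (0:ℝ)..R, Real.sin t ^ k) := mul_le_mul_left hlower _

/-- **The Bishop–Gromov relative volume comparison theorem on a closed manifold** (Chavel 2006,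
Thm. III.4.5; Lee 2018, Thm. 11.19), `κ = 1`, division-free: on a compact connected Riemannian
`m`-manifold, `m ≥ 2`, with `Ric ≥ (m - 1) g`, for `0 < r ≤ R ≤ π`,
`Vol B̄_R(p) · ∫₀ʳ sin^{m-1} ≤ Vol B̄_r(p) · ∫₀ᴿ sin^{m-1}`
(`riemVolume_closedBall_mul_le_of_ricci_ge`, closed balls being compact).
[cite: Chavel2006, Thm. III.4.5] -/
theorem riemVolume_closedBall_mul_le_of_ricci_ge_of_compactSpace [CompactSpace M]
    (hg : g.IsRiemannian) (hm : 2 ≤ m)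
    (hRic : ∀ (x : M) (w : TangentSpace (𝓡 m) x), ((m : ℝ) - 1) * g.val x w w ≤ g.ricci x w w)
    (p : M) {r R : ℝ} (hr0 : 0 < r) (hrR : r ≤ R) (hRπ : R ≤ Real.pi) :
    g.riemVolume {y : M | g.edist hg p y ≤ ENNReal.ofReal R} *
        ENNReal.ofReal (∫ t in (0:ℝ)..r, Real.sin t ^ (m - 1)) ≤
      g.riemVolume {y : M | g.edist hg p y ≤ ENNReal.ofReal r} *
        ENNReal.ofReal (∫ t in (0:ℝ)..R, Real.sin t ^ (m - 1)) :=
  riemVolume_closedBall_mul_le_of_ricci_ge g hg hm (isCompact_setOf_edist_le_of_compactSpace g hg)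
    hRic p hr0 hrR hRπ

/-- **Relative volume lower bound for balls of a closed manifold with `Ric ≥ m - 1`**
(Bishop–Gromov, Chavel 2006, Thm. III.4.5, between `r` and `R = π`, with Myers' theorem
`M = B̄_π(p)` (`edist_le_pi_div_sqrt_of_ricci_ge_of_compactSpace`) and
`|S^{m-1}| ∫₀^π sin^{m-1} = |Sᵐ|` (`unitSphereVolume_succ_eq_mul_integral_sin_pow`)): for every
`p` and `0 < r ≤ π`,
`Vol(M) · |S^{m-1}| ∫₀ʳ sin^{m-1} ≤ Vol B̄_r(p) · |Sᵐ|`, i.e. `Vol B̄_r(p)/Vol(M) ≥ V₁(r)/|Sᵐ|` —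
the form used for lower volume bounds of small balls under `Ric ≥ n - 1` (Cheeger–Colding 1997,
(0.5) with `R = π`; Colding 1997, *Aspects*, §2). [cite: Chavel2006, Thm. III.4.5]
[cite: CheegerColding1997, (0.5)] -/
theorem riemVolume_univ_mul_le_riemVolume_closedBall_mul [CompactSpace M] (hg : g.IsRiemannian)
    (hm : 2 ≤ m)
    (hRic : ∀ (x : M) (w : TangentSpace (𝓡 m) x), ((m : ℝ) - 1) * g.val x w w ≤ g.ricci x w w)
    (p : M) {r : ℝ} (hr0 : 0 < r) (hrπ : r ≤ Real.pi) :
    g.riemVolume (univ : Set M) *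
        ENNReal.ofReal (unitSphereVolume (m - 1) * ∫ t in (0:ℝ)..r, Real.sin t ^ (m - 1)) ≤
      g.riemVolume {y : M | g.edist hg p y ≤ ENNReal.ofReal r} *
        ENNReal.ofReal (unitSphereVolume m) := by
  have key := riemVolume_closedBall_mul_le_of_ricci_ge_of_compactSpace g hg hm hRic p hr0 hrπ
    le_rfl
  obtain ⟨k, rfl⟩ : ∃ k, m = k + 1 := ⟨m - 1, by omega⟩
  have hfinE : Module.finrank ℝ (EuclideanSpace ℝ (Fin (k + 1))) = k + 1 :=
    finrank_euclideanSpace_fin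
  -- Myers: `M = B̄_π(p)`
  have hRic' : ∀ (x : M) (w : TangentSpace (𝓡 (k + 1)) x),
      ((Module.finrank ℝ (EuclideanSpace ℝ (Fin (k + 1))) : ℝ) - 1) * 1 * g.val x w w ≤
        g.leviCivita.ricci x w w := by
    intro x w
    rw [hfinE, mul_one]
    exact hRic x w
  have hball : (univ : Set M) = {y : M | g.edist hg p y ≤ ENNReal.ofReal Real.pi} := by
    refine (eq_univ_of_forall fun y ↦ ?_).symm
    have h := edist_le_pi_div_sqrt_of_ricci_ge_of_compactSpace g hg (by rw [hfinE]; exact hm)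
      one_pos hRic' p y
    rwa [Real.sqrt_one, div_one] at h
  rw [Nat.add_sub_cancel] at key ⊢
  rw [hball, unitSphereVolume_succ_eq_mul_integral_sin_pow k,
    ENNReal.ofReal_mul (unitSphereVolume_pos k).le, ENNReal.ofReal_mul (unitSphereVolume_pos k).le]
  calc g.riemVolume {y : M | g.edist hg p y ≤ ENNReal.ofReal Real.pi} *
        (ENNReal.ofReal (unitSphereVolume k) * ENNReal.ofReal (∫ t in (0:ℝ)..r, Real.sin t ^ k))
      = ENNReal.ofReal (unitSphereVolume k) *
          (g.riemVolume {y : M | g.edist hg p y ≤ ENNReal.ofReal Real.pi} *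
            ENNReal.ofReal (∫ t in (0:ℝ)..r, Real.sin t ^ k)) := by ring
    _ ≤ ENNReal.ofReal (unitSphereVolume k) *
          (g.riemVolume {y : M | g.edist hg p y ≤ ENNReal.ofReal r} *
            ENNReal.ofReal (∫ t in (0:ℝ)..Real.pi, Real.sin t ^ k)) := mul_le_mul_right key _
    _ = g.riemVolume {y : M | g.edist hg p y ≤ ENNReal.ofReal r} *
          (ENNReal.ofReal (unitSphereVolume k) *
            ENNReal.ofReal (∫ t in (0:ℝ)..Real.pi, Real.sin t ^ k)) := by ring

end Main

/-! ### §5. The relative volume lower bound in the binders of `Colding1996_volume_ghClose` -/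

section FactVocabulary

open Lorentzian (riemannianMeasure)

/-- **Relative volume lower bound for balls, in the vocabulary of the named fact
`Colding1996_volume_ghClose`** (`VolumeSphereTheoremGHDecomposition.lean`): for `n ≥ 2`, a
compact connected `C^∞` `n`-manifold `M` with a `C^∞` Riemannian metric `h` (Mathlib's
`Bundle.ContMDiffRiemannianMetric`, with the tree's Levi-Civita/Ricci API through
`PseudoRiemannianMetric.ofRiemannian h`) and `Ric_h ≥ (n - 1) h`, every closed ball of the length
distance `d_h = Manifold.riemannianEDist` (the distance entering `IsRoundSphereGHApprox`) satisfies
`riemannianMeasure h univ · |S^{n-1}| ∫₀ʳ sin^{n-1} ≤ riemannianMeasure h B̄_r(p) · |Sⁿ|`,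
`0 < r ≤ π`. This is `riemVolume_univ_mul_le_riemVolume_closedBall_mul` transported along the
definitional bridges `(ofRiemannian h).riemVolume = riemannianMeasure h`,
`(ofRiemannian h).edist = riemannianEDist` — the relative volume comparison as it is quoted in
the proof of Colding's theorem (Cheeger–Colding 1997, (0.5); Colding 1997, *Aspects*, §2).
[cite: Chavel2006, Thm. III.4.5] [cite: CheegerColding1997, (0.5)] -/
theorem riemannianMeasure_univ_mul_le_closedBall_mul (n : ℕ) (hn : 2 ≤ n)
    (M : Type) [TopologicalSpace M] [T2Space M] [SecondCountableTopology M]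
    [ChartedSpace (EuclideanSpace ℝ (Fin n)) M] [IsManifold (𝓡 n) ∞ M] [CompactSpace M]
    [ConnectedSpace M] [MeasurableSpace M] [BorelSpace M]
    (h : Bundle.ContMDiffRiemannianMetric (𝓡 n) ∞ (EuclideanSpace ℝ (Fin n))
      (TangentSpace (𝓡 n) : M → Type _))
    [(PseudoRiemannianMetric.ofRiemannian h).HasLeviCivita]
    (hRic : ∀ (x : M) (v : TangentSpace (𝓡 n) x),
      ((n : ℝ) - 1) * h.inner x v v ≤ (PseudoRiemannianMetric.ofRiemannian h).ricci x v v)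
    (p : M) {r : ℝ} (hr0 : 0 < r) (hrπ : r ≤ Real.pi) :
    riemannianMeasure h Set.univ *
        ENNReal.ofReal (unitSphereVolume (n - 1) * ∫ t in (0:ℝ)..r, Real.sin t ^ (n - 1)) ≤
      riemannianMeasure h {y : M |
          (letI : Bundle.RiemannianBundle (fun x : M ↦ TangentSpace (𝓡 n) x) :=
            ⟨h.toContinuousRiemannianMetric.toRiemannianMetric⟩
          Manifold.riemannianEDist (𝓡 n) p y) ≤ ENNReal.ofReal r} *
        ENNReal.ofReal (unitSphereVolume n) := by
  set g := PseudoRiemannianMetric.ofRiemannian h with hg_def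
  have hg : g.IsRiemannian := PseudoRiemannianMetric.isRiemannian_ofRiemannian h
  have key := riemVolume_univ_mul_le_riemVolume_closedBall_mul g hg hn (fun x v ↦ hRic x v) p
    hr0 hrπ
  rw [PseudoRiemannianMetric.riemVolume_eq hg] at key
  exact key

end FactVocabulary

/-! ### §6. Sets of almost full measure are dense (relative volume comparison, contrapositive) -/

section Density

variable {m : ℕ} {M : Type*} [TopologicalSpace M] [T2Space M] [SecondCountableTopology M]
  [ChartedSpace (EuclideanSpace ℝ (Fin m)) M] [IsManifold (𝓡 m) ∞ M] [T3Space M]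
  [MeasurableSpace M] [BorelSpace M]
  (g : PseudoRiemannianMetric (𝓡 m) ∞ (EuclideanSpace ℝ (Fin m)) (TangentSpace (𝓡 m) : M → Type _))
  [ConnectedSpace M] [CompactSpace M] [g.HasLeviCivita]

/-- **Sets of almost full measure are `ε`-dense** (the use of relative volume comparison in
Colding's Gromov–Hausdorff assembly, Colding 1997, *Aspects*, proof of Thm. 2.2; Cheeger–Colding
1997, (0.5)): on a compact connected Riemannian `m`-manifold, `m ≥ 2`, with `Ric ≥ (m - 1) g`,
if `Vol(Sᶜ) · |Sᵐ| < Vol(M) · |S^{m-1}| ∫₀^ε sin^{m-1}` (`0 < ε ≤ π`) then every point of `M` is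
within distance `ε` of `S` — otherwise the closed `ε`-ball about a far point lies in `Sᶜ` and
`riemVolume_univ_mul_le_riemVolume_closedBall_mul` is contradicted.
[cite: Chavel2006, Thm. III.4.5] [cite: Colding1997Aspects, proof of Thm. 2.2] -/
theorem exists_mem_edist_le_of_riemVolume_compl_mul_lt (hg : g.IsRiemannian) (hm : 2 ≤ m)
    (hRic : ∀ (x : M) (w : TangentSpace (𝓡 m) x), ((m : ℝ) - 1) * g.val x w w ≤ g.ricci x w w)
    {S : Set M} {ε : ℝ} (hε0 : 0 < ε) (hεπ : ε ≤ Real.pi)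
    (hS : g.riemVolume Sᶜ * ENNReal.ofReal (unitSphereVolume m) <
      g.riemVolume (univ : Set M) *
        ENNReal.ofReal (unitSphereVolume (m - 1) * ∫ t in (0:ℝ)..ε, Real.sin t ^ (m - 1)))
    (p : M) : ∃ s ∈ S, g.edist hg p s ≤ ENNReal.ofReal ε := by
  by_contra hno
  push Not at hno
  have hsub : {y : M | g.edist hg p y ≤ ENNReal.ofReal ε} ⊆ Sᶜ := fun y hy hyS ↦
    (not_le.2 (hno y hyS)) hy
  have h1 := riemVolume_univ_mul_le_riemVolume_closedBall_mul g hg hm hRic p hε0 hεπ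
  have h2 : g.riemVolume {y : M | g.edist hg p y ≤ ENNReal.ofReal ε} *
      ENNReal.ofReal (unitSphereVolume m) ≤ g.riemVolume Sᶜ * ENNReal.ofReal (unitSphereVolume m) :=
    mul_le_mul_left (measure_mono hsub) _
  exact lt_irrefl _ ((h1.trans h2).trans_lt hS)

end Density

section DensityFact

open Lorentzian (riemannianMeasure)

/-- **Sets of almost full measure are `ε`-dense, in the binders of `Colding1996_volume_ghClose`**:
for `n ≥ 2`, a compact connected `C^∞` Riemannian `n`-manifold `(M, h)` with `Ric_h ≥ (n - 1) h`,
`S ⊆ M` and `0 < ε ≤ π` with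
`riemannianMeasure h Sᶜ · |Sⁿ| < riemannianMeasure h M · |S^{n-1}| ∫₀^ε sin^{n-1}`, every point is
within `d_h ≤ ε` of `S` (`d_h = Manifold.riemannianEDist`). Transport of
`exists_mem_edist_le_of_riemVolume_compl_mul_lt` along the definitional bridges.
[cite: Chavel2006, Thm. III.4.5] [cite: Colding1997Aspects, proof of Thm. 2.2] -/
theorem exists_mem_riemannianEDist_le_of_measure_compl_mul_lt (n : ℕ) (hn : 2 ≤ n)
    (M : Type) [TopologicalSpace M] [T2Space M] [SecondCountableTopology M]
    [ChartedSpace (EuclideanSpace ℝ (Fin n)) M] [IsManifold (𝓡 n) ∞ M] [CompactSpace M]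
    [ConnectedSpace M] [MeasurableSpace M] [BorelSpace M]
    (h : Bundle.ContMDiffRiemannianMetric (𝓡 n) ∞ (EuclideanSpace ℝ (Fin n))
      (TangentSpace (𝓡 n) : M → Type _))
    [(PseudoRiemannianMetric.ofRiemannian h).HasLeviCivita]
    (hRic : ∀ (x : M) (v : TangentSpace (𝓡 n) x),
      ((n : ℝ) - 1) * h.inner x v v ≤ (PseudoRiemannianMetric.ofRiemannian h).ricci x v v)
    {S : Set M} {ε : ℝ} (hε0 : 0 < ε) (hεπ : ε ≤ Real.pi)
    (hS : riemannianMeasure h Sᶜ * ENNReal.ofReal (unitSphereVolume n) <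
      riemannianMeasure h Set.univ *
        ENNReal.ofReal (unitSphereVolume (n - 1) * ∫ t in (0:ℝ)..ε, Real.sin t ^ (n - 1)))
    (p : M) :
    ∃ s ∈ S, (letI : Bundle.RiemannianBundle (fun x : M ↦ TangentSpace (𝓡 n) x) :=
        ⟨h.toContinuousRiemannianMetric.toRiemannianMetric⟩
      Manifold.riemannianEDist (𝓡 n) p s) ≤ ENNReal.ofReal ε := by
  set g := PseudoRiemannianMetric.ofRiemannian h with hg_def
  have hg : g.IsRiemannian := PseudoRiemannianMetric.isRiemannian_ofRiemannian h
  have hS' : g.riemVolume Sᶜ * ENNReal.ofReal (unitSphereVolume n) <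
      g.riemVolume (univ : Set M) *
        ENNReal.ofReal (unitSphereVolume (n - 1) * ∫ t in (0:ℝ)..ε, Real.sin t ^ (n - 1)) := by
    rw [PseudoRiemannianMetric.riemVolume_eq hg]
    exact hS
  obtain ⟨s, hs, hd⟩ :=
    exists_mem_edist_le_of_riemVolume_compl_mul_lt g hg hn (fun x v ↦ hRic x v) hε0 hεπ hS' p
  exact ⟨s, hs, hd⟩

end DensityFact

/-! ### §7. Packing: `ε`-separated sets have at most `|Sᵐ| / V₁(ε/2)` points -/

section Packing

variable {m : ℕ} {M : Type*} [TopologicalSpace M] [T2Space M] [SecondCountableTopology M]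
  [ChartedSpace (EuclideanSpace ℝ (Fin m)) M] [IsManifold (𝓡 m) ∞ M] [T3Space M]
  [MeasurableSpace M] [BorelSpace M]
  (g : PseudoRiemannianMetric (𝓡 m) ∞ (EuclideanSpace ℝ (Fin m)) (TangentSpace (𝓡 m) : M → Type _))
  [ConnectedSpace M] [CompactSpace M] [g.HasLeviCivita]

/-- **Packing bound under `Ric ≥ m - 1`** (Gromov's volume counting, as used for the choice of
almost orthogonal frames in Colding's assembly and in Gromov's precompactness theorem; Chavel 2006,
Thm. III.4.5 with Myers): on a compact connected Riemannian `m`-manifold, `m ≥ 2`, with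
`Ric ≥ (m - 1) g`, a finite `ε`-separated set `F` (`d(x, y) > ε` for distinct `x, y ∈ F`),
`0 < ε ≤ 2π`, satisfies `#F · |S^{m-1}| ∫₀^{ε/2} sin^{m-1} ≤ |Sᵐ|`. Proof: the closed `ε/2`-balls
about the points of `F` are pairwise disjoint, each has `Vol B̄ · |Sᵐ| ≥ Vol(M) · V₁(ε/2)`
(`riemVolume_univ_mul_le_riemVolume_closedBall_mul`), their total volume is at most `Vol(M)`, and
`0 < Vol(M) < ∞` (`isOpenPosMeasure_riemannianMeasure`, `riemVolume_univ_le_unitSphereVolume`).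
[cite: Chavel2006, Thm. III.4.5] [cite: Colding1997Aspects, proof of Thm. 2.2] -/
theorem card_mul_le_unitSphereVolume_of_edist_gt (hg : g.IsRiemannian) (hm : 2 ≤ m)
    (hRic : ∀ (x : M) (w : TangentSpace (𝓡 m) x), ((m : ℝ) - 1) * g.val x w w ≤ g.ricci x w w)
    {ε : ℝ} (hε0 : 0 < ε) (hε : ε ≤ 2 * Real.pi) (F : Finset M)
    (hsep : ∀ x ∈ F, ∀ y ∈ F, x ≠ y → ENNReal.ofReal ε < g.edist hg x y) :
    (F.card : ℝ≥0∞) *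
        ENNReal.ofReal (unitSphereVolume (m - 1) * ∫ t in (0:ℝ)..ε / 2, Real.sin t ^ (m - 1)) ≤
      ENNReal.ofReal (unitSphereVolume m) := by
  rcases F.eq_empty_or_nonempty with rfl | ⟨x₀, -⟩
  · simp
  -- `0 < Vol(M) < ∞`
  have hfin : g.riemVolume (univ : Set M) ≠ ⊤ :=
    ((riemVolume_univ_le_unitSphereVolume g hg hm hRic).trans_lt ENNReal.ofReal_lt_top).ne
  have hpos : g.riemVolume (univ : Set M) ≠ 0 := by
    haveI : g.riemVolume.IsOpenPosMeasure := by
      rw [PseudoRiemannianMetric.riemVolume_eq hg]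
      exact isOpenPosMeasure_riemannianMeasure _
    exact isOpen_univ.measure_ne_zero g.riemVolume ⟨x₀, mem_univ _⟩
  -- the closed `ε/2`-balls about the points of `F` are measurable and pairwise disjoint
  set B : M → Set M := fun x ↦ {y : M | g.edist hg x y ≤ ENNReal.ofReal (ε / 2)} with hB_def
  have hmeasB : ∀ x ∈ F, MeasurableSet (B x) := fun x _ ↦
    (isClosed_le ((PseudoRiemannianMetric.continuous_edist hg).comp
      (continuous_const.prodMk continuous_id)) continuous_const).measurableSet
  have hdisj : (F : Set M).PairwiseDisjoint B := by
    intro x hx y hy hxy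
    rw [Function.onFun, Set.disjoint_left]
    intro z hzx hzy
    have hzx' : g.edist hg x z ≤ ENNReal.ofReal (ε / 2) := hzx
    have hzy' : g.edist hg z y ≤ ENNReal.ofReal (ε / 2) := by
      rw [PseudoRiemannianMetric.edist_comm hg]
      exact hzy
    have hle : g.edist hg x y ≤ ENNReal.ofReal ε :=
      calc g.edist hg x y ≤ g.edist hg x z + g.edist hg z y :=
            PseudoRiemannianMetric.edist_triangle hg x z y
        _ ≤ ENNReal.ofReal (ε / 2) + ENNReal.ofReal (ε / 2) := add_le_add hzx' hzy'
        _ = ENNReal.ofReal ε := by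
            rw [← ENNReal.ofReal_add (by positivity) (by positivity), add_halves]
    exact (not_lt.2 hle) (hsep x hx y hy hxy)
  -- volume counting
  have hball : ∀ x ∈ F, g.riemVolume (univ : Set M) *
      ENNReal.ofReal (unitSphereVolume (m - 1) * ∫ t in (0:ℝ)..ε / 2, Real.sin t ^ (m - 1)) ≤
      g.riemVolume (B x) * ENNReal.ofReal (unitSphereVolume m) := fun x _ ↦
    riemVolume_univ_mul_le_riemVolume_closedBall_mul g hg hm hRic x (by positivity) (by linarith)
  have hsum : (F.card : ℝ≥0∞) * (g.riemVolume (univ : Set M) *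
      ENNReal.ofReal (unitSphereVolume (m - 1) * ∫ t in (0:ℝ)..ε / 2, Real.sin t ^ (m - 1))) ≤
      g.riemVolume (univ : Set M) * ENNReal.ofReal (unitSphereVolume m) :=
    calc (F.card : ℝ≥0∞) * (g.riemVolume (univ : Set M) *
          ENNReal.ofReal (unitSphereVolume (m - 1) * ∫ t in (0:ℝ)..ε / 2, Real.sin t ^ (m - 1)))
        = ∑ x ∈ F, g.riemVolume (univ : Set M) *
            ENNReal.ofReal (unitSphereVolume (m - 1) * ∫ t in (0:ℝ)..ε / 2, Real.sin t ^ (m - 1)) := by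
          rw [Finset.sum_const, nsmul_eq_mul]
      _ ≤ ∑ x ∈ F, g.riemVolume (B x) * ENNReal.ofReal (unitSphereVolume m) :=
          Finset.sum_le_sum hball
      _ = (∑ x ∈ F, g.riemVolume (B x)) * ENNReal.ofReal (unitSphereVolume m) :=
          (Finset.sum_mul _ _ _).symm
      _ = g.riemVolume (⋃ x ∈ F, B x) * ENNReal.ofReal (unitSphereVolume m) := by
          rw [measure_biUnion_finset hdisj hmeasB]
      _ ≤ g.riemVolume (univ : Set M) * ENNReal.ofReal (unitSphereVolume m) :=
          mul_le_mul_left (measure_mono (subset_univ _)) _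
  rw [mul_left_comm] at hsum
  exact (ENNReal.mul_le_mul_iff_right hpos hfin).1 hsum

end Packing

/-! ### §8. Almost maximal total volume ⇒ every ball has almost maximal volume -/

section AlmostMaximalBalls

variable {m : ℕ} {M : Type*} [TopologicalSpace M] [T2Space M] [SecondCountableTopology M]
  [ChartedSpace (EuclideanSpace ℝ (Fin m)) M] [IsManifold (𝓡 m) ∞ M] [T3Space M]
  [MeasurableSpace M] [BorelSpace M]
  (g : PseudoRiemannianMetric (𝓡 m) ∞ (EuclideanSpace ℝ (Fin m)) (TangentSpace (𝓡 m) : M → Type _))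
  [ConnectedSpace M] [CompactSpace M] [g.HasLeviCivita]

/-- **Almost maximal volume is inherited by all balls** (the use of relative volume comparison
throughout Colding's proof, Colding 1997, *Aspects*, remark after Thm. 2.2 and proof of Thm. 2.2;
Cheeger–Colding 1997, (0.5)): on a compact connected Riemannian `m`-manifold, `m ≥ 2`, with
`Ric ≥ (m - 1) g` and `Vol(M) ≥ (1 − δ)|Sᵐ|`, every closed ball satisfies
`Vol B̄_r(p) ≥ (1 − δ) V₁(r)`, `V₁(r) = |S^{m-1}| ∫₀ʳ sin^{m-1}`, `0 < r ≤ π` — to be read with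
Bishop's `Vol B̄_r(p) ≤ V₁(r)` (`riemVolume_closedBall_le_of_ricci_ge_of_compactSpace`): the balls
of `M` have almost the volume of the balls of `Sᵐ`. Proof: `Vol(M) · V₁(r) ≤ Vol B̄_r(p) · |Sᵐ|`
(`riemVolume_univ_mul_le_riemVolume_closedBall_mul`) and `|Sᵐ| > 0`.
[cite: Colding1997Aspects, Thm. 2.2 and the remark following it (p. 88)]
[cite: CheegerColding1997, (0.5)] -/
theorem ofReal_one_sub_mul_le_riemVolume_closedBall (hg : g.IsRiemannian) (hm : 2 ≤ m)
    (hRic : ∀ (x : M) (w : TangentSpace (𝓡 m) x), ((m : ℝ) - 1) * g.val x w w ≤ g.ricci x w w)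
    {δ : ℝ} (hvol : ENNReal.ofReal ((1 - δ) * unitSphereVolume m) ≤ g.riemVolume (univ : Set M))
    (p : M) {r : ℝ} (hr0 : 0 < r) (hrπ : r ≤ Real.pi) :
    ENNReal.ofReal ((1 - δ) *
        (unitSphereVolume (m - 1) * ∫ t in (0:ℝ)..r, Real.sin t ^ (m - 1))) ≤
      g.riemVolume {y : M | g.edist hg p y ≤ ENNReal.ofReal r} := by
  set V : ℝ := unitSphereVolume (m - 1) * ∫ t in (0:ℝ)..r, Real.sin t ^ (m - 1) with hV
  rcases le_or_gt δ 1 with hδ | hδ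
  swap
  · rw [ENNReal.ofReal_of_nonpos]
    · exact zero_le
    · have hV0 : 0 ≤ V := mul_nonneg (unitSphereVolume_pos _).le
        (intervalIntegral.integral_nonneg hr0.le fun t ht ↦
          pow_nonneg (Real.sin_nonneg_of_nonneg_of_le_pi ht.1 (ht.2.trans hrπ)) _)
      exact mul_nonpos_of_nonpos_of_nonneg (by linarith) hV0
  have h1δ : 0 ≤ 1 - δ := sub_nonneg.2 hδ
  have hS0 : ENNReal.ofReal (unitSphereVolume m) ≠ 0 :=
    (ENNReal.ofReal_pos.2 (unitSphereVolume_pos m)).ne'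
  have key := riemVolume_univ_mul_le_riemVolume_closedBall_mul g hg hm hRic p hr0 hrπ
  -- `(1 - δ)|Sᵐ| · V ≤ Vol(M) · V ≤ Vol B̄_r · |Sᵐ|`
  have h2 : ENNReal.ofReal (unitSphereVolume m) * ENNReal.ofReal ((1 - δ) * V) ≤
      ENNReal.ofReal (unitSphereVolume m) *
        g.riemVolume {y : M | g.edist hg p y ≤ ENNReal.ofReal r} :=
    calc ENNReal.ofReal (unitSphereVolume m) * ENNReal.ofReal ((1 - δ) * V)
        = ENNReal.ofReal ((1 - δ) * unitSphereVolume m) * ENNReal.ofReal V := by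
          rw [← ENNReal.ofReal_mul (unitSphereVolume_pos m).le, ← ENNReal.ofReal_mul
            (mul_nonneg h1δ (unitSphereVolume_pos m).le)]
          ring_nf
      _ ≤ g.riemVolume (univ : Set M) * ENNReal.ofReal V := mul_le_mul_left hvol _
      _ ≤ g.riemVolume {y : M | g.edist hg p y ≤ ENNReal.ofReal r} *
            ENNReal.ofReal (unitSphereVolume m) := key
      _ = ENNReal.ofReal (unitSphereVolume m) *
            g.riemVolume {y : M | g.edist hg p y ≤ ENNReal.ofReal r} := mul_comm _ _
  exact (ENNReal.mul_le_mul_iff_right hS0 ENNReal.ofReal_ne_top).1 h2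

end AlmostMaximalBalls

section AlmostMaximalBallsFact

open Lorentzian (riemannianMeasure)

/-- **Almost maximal volume is inherited by all balls, in the binders of
`Colding1996_volume_ghClose`**: for `n ≥ 2`, a compact connected `C^∞` Riemannian `n`-manifold
`(M, h)` with `Ric_h ≥ (n − 1) h` and `riemannianMeasure h univ ≥ (1 − δ)|Sⁿ|` (the volume
hypothesis of the fact), every closed `d_h`-ball (`d_h = Manifold.riemannianEDist`) has
`riemannianMeasure h B̄_r(p) ≥ (1 − δ) |S^{n-1}| ∫₀ʳ sin^{n-1}`, `0 < r ≤ π`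
(`ofReal_one_sub_mul_le_riemVolume_closedBall` along the definitional bridges).
[cite: Colding1997Aspects, Thm. 2.2 and the remark following it (p. 88)]
[cite: CheegerColding1997, (0.5)] -/
theorem ofReal_one_sub_mul_le_riemannianMeasure_closedBall (n : ℕ) (hn : 2 ≤ n)
    (M : Type) [TopologicalSpace M] [T2Space M] [SecondCountableTopology M]
    [ChartedSpace (EuclideanSpace ℝ (Fin n)) M] [IsManifold (𝓡 n) ∞ M] [CompactSpace M]
    [ConnectedSpace M] [MeasurableSpace M] [BorelSpace M]
    (h : Bundle.ContMDiffRiemannianMetric (𝓡 n) ∞ (EuclideanSpace ℝ (Fin n))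
      (TangentSpace (𝓡 n) : M → Type _))
    [(PseudoRiemannianMetric.ofRiemannian h).HasLeviCivita]
    (hRic : ∀ (x : M) (v : TangentSpace (𝓡 n) x),
      ((n : ℝ) - 1) * h.inner x v v ≤ (PseudoRiemannianMetric.ofRiemannian h).ricci x v v)
    {δ : ℝ} (hvol : ENNReal.ofReal ((1 - δ) * unitSphereVolume n) ≤ riemannianMeasure h Set.univ)
    (p : M) {r : ℝ} (hr0 : 0 < r) (hrπ : r ≤ Real.pi) :
    ENNReal.ofReal ((1 - δ) *
        (unitSphereVolume (n - 1) * ∫ t in (0:ℝ)..r, Real.sin t ^ (n - 1))) ≤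
      riemannianMeasure h {y : M |
          (letI : Bundle.RiemannianBundle (fun x : M ↦ TangentSpace (𝓡 n) x) :=
            ⟨h.toContinuousRiemannianMetric.toRiemannianMetric⟩
          Manifold.riemannianEDist (𝓡 n) p y) ≤ ENNReal.ofReal r} := by
  set g := PseudoRiemannianMetric.ofRiemannian h with hg_def
  have hg : g.IsRiemannian := PseudoRiemannianMetric.isRiemannian_ofRiemannian h
  have hvol' : ENNReal.ofReal ((1 - δ) * unitSphereVolume n) ≤ g.riemVolume (univ : Set M) := by
    rw [PseudoRiemannianMetric.riemVolume_eq hg]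
    exact hvol
  have key := ofReal_one_sub_mul_le_riemVolume_closedBall g hg hn (fun x v ↦ hRic x v) hvol' p
    hr0 hrπ
  rw [PseudoRiemannianMetric.riemVolume_eq hg] at key
  exact key

end AlmostMaximalBallsFact

end Literature.Geometry.Riemannian

end
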